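import Mathlib
import Literature.NumberTheory.LFunctions.Zhang2022.Section7SjStarEqSj
import Literature.NumberTheory.LFunctions.MontgomeryOffDiagonalTools
import HarnessLib

/-!
# Zhang (2022) §7, proof of Proposition 7.1 (c): the residue extraction (7.19) → (7.20) —
# edges `Z22:§7.u049`, `Z22:§7.u052`, `Z22:(7.20)`, kernel-checked

Topic `Literature/NumberTheory/LFunctions/Zhang2022` (Landau–Siegel audit tree; verdict-neutral).
D-0069 campaign, cell `siegel-zhang`, DISCHARGE lane (seat `sz-d25`, block F3 "§7d residue
extraction"). Y. Zhang, *Discrete mean estimates and the Landau–Siegel zero*, arXiv:2211.02515v1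
(2022) [Zhang2022LandauSiegel] — **an unrefereed manuscript under adjudication**; this file PROVES
three printed inferences between typed proof steps of `Section7dStatements` (slice L2-t5) and
asserts nothing else — in particular nothing about Theorems 1–2 or about Landau–Siegel zeros. It
does NOT assert the contour move `Z22:§7.u047` or the residue formula `Z22:§7.u049` (CLAIM nodes,
consumed as hypotheses; the contour's zero-free presupposition is the campaign's row G-adj2-3).

The passage (§7 pp. 40–41, tex L2093–L2140), after (7.18)–(7.19):
"… we can move the contour of integration … [§7.u047]. This yields, by Lemma 5.2 (i) and standard
estimates, … `Σ_{(l,kd₂)=1} κ(d₁l)Δ(ll₂/(pk)) = Σ_{1≤j≤3} 𝔯ⱼκ̃₀ⱼ(d₁;d₂k)λ₀ⱼ(d₁d₂k)(pk/l₂)^{1−β_j}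
+ O(pkε₁/l₂)` [§7.u049] … This yields `Σ_{(l₂,k)=1} a₁(d₂l₂)Σ_{(l₁,kd₂)=1}κ(d₁l₁)Δ(l₁l₂/(pk))
= Σ_j 𝔯ⱼ(pk)^{1−β_j}κ̃₀ⱼλ₀ⱼ Σ_{(l,k)=1}a₁(d₂l)l^{−(1−β_j)} + O(Pkε₁)` [§7.u052]. Inserting this into
(7.18) and rearranging the terms we obtain `𝔗₁₁(p) = Σ_j 𝔯ⱼp^{1−β_j}S*ⱼ(𝐚₁,𝐚₂) + O(Pε₁)` (7.20)."

| decl | node | content |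
|---|---|---|
| `step7u049_of` | `Z22:§7.u049` ⇐ (7.19), §7.u045, §7.u047 + contour bound | given the Mellin formula `Eq719`, the Euler-product identity `Step7u045` (the two Mellin integrands agree on `σ = 3/2`) and the contour move `Step7u047`, the node IS the "standard estimates" bound `‖(1/2πi)∫_𝒞(l₂/pk)^{−s}κ̃λζζζζ⁻¹δ ds‖ ≤ C·pkε₁/l₂`, taken as an explicit hypothesis; `(l₂/pk)^{−(1−β_j)} = (pk/l₂)^{1−β_j}` |
| `ded7u052_of` | `Z22:§7.u052` ⇐ `Z22:§7.u049` | multiply by `a₁(d₂l₂)` (bounded by the (7.2) constant `B`, zero for `d₂l₂ ≥ PT⁻²`: both `l`-series are finite sums over `l < ⌈PT⁻²⌉`), `(pk/l₂)^{1−β_j} = (pk)^{1−β_j}/l₂^{1−β_j}`, error `≤ 3BC·Pk·ε₁(c)(2 + 𝓛⁹) ≤ Pk·ε₁(c/2)` |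
| `eq720_of` | `Z22:(7.20)` ⇐ (7.18), `Z22:§7.u052` | `(pk)^{1−β_j}μ(k)/(d₁d₂kφ(k)) = p^{1−β_j}μ(k)/(d₁d₂φ(k)k^{β_j})` recognises `SjStar` verbatim; error `≤ 12BC·Pε₁(c)(2+𝓛⁹)³` via `(Σ_{d<PT⁻²}d⁻¹)²Σ_{k<PT⁻²}φ(k)⁻¹` (`Montgomery.sum_Icc_inv_totient_le`) `≤ P·ε₁(c/8)` |
| `absorb_log_eps1` | — | `∀ K, c₀ > 0: K(2 + 𝓛⁹)ε₁(c₀) ≤ ε₁(c₀/2)` for large `D` (`x⁹⁰/90! ≤ eˣ`): powers of `𝓛 = log D` are absorbed by halving the node's own constant in `ε₁ = exp{−c𝓛^{1/10}}` |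

Every node of the chain quantifies its own `∃ c > 0` in `ε₁`; the edges here halve it (u052) and
divide it by eight ((7.20)). No named fact, no numerics; inputs: the hypotheses named above, the
(7.2) support/bound clause `Skeleton.Adm72`, `harmonic_le_one_add_log`,
`Montgomery.sum_Icc_inv_totient_le`, and elementary calculus.

## References

* Y. Zhang, arXiv:2211.02515v1 (2022), §7 pp. 40–41, proof of Proposition 7.1 (c), displays
  (7.18)–(7.20) and the two "This yields" displays between them.
  [cite: Zhang2022LandauSiegel, §7 pp.40–41, tex L2093–L2140]
-/

noncomputable section

open Complex Real Finset
open scoped ArithmeticFunction.Moebius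

namespace Literature.NumberTheory.LFunctions.Zhang2022.Section7dStatements

/-! ## Elementary helpers -/

/-- A positive-real quotient under a complex power splits. [folklore] -/
private theorem ofReal_div_cpow {x y : ℝ} (hx : 0 < x) (hy : 0 < y) (s : ℂ) :
    ((x / y : ℝ) : ℂ) ^ s = (x : ℂ) ^ s / (y : ℂ) ^ s := by
  have hx0 : (x : ℂ) ≠ 0 := by exact_mod_cast hx.ne'
  have hy0 : (y : ℂ) ≠ 0 := by exact_mod_cast hy.ne'
  have hxy0 : ((x / y : ℝ) : ℂ) ≠ 0 := by exact_mod_cast (div_pos hx hy).ne'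
  rw [Complex.cpow_def_of_ne_zero hxy0, Complex.cpow_def_of_ne_zero hx0,
    Complex.cpow_def_of_ne_zero hy0, ← Complex.exp_sub]
  congr 1
  rw [← Complex.ofReal_log (div_pos hx hy).le, Real.log_div hx.ne' hy.ne',
    ← Complex.ofReal_log hx.le, ← Complex.ofReal_log hy.le]
  push_cast
  ring

/-- Harmonic bound on `[1, N)`: `Σ_{1≤l<N} 1/l ≤ 1 + log N`. [folklore] -/
private theorem sum_Ico_inv_le_log (N : ℕ) :
    ∑ l ∈ Finset.Ico 1 N, 1 / (l : ℝ) ≤ 1 + Real.log N := by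
  rcases Nat.lt_or_ge N 2 with hN | hN
  · interval_cases N <;> simp
  have h1 : ∑ l ∈ Finset.Ico 1 N, 1 / (l : ℝ) = (harmonic (N - 1) : ℝ) := by
    rw [harmonic, Finset.sum_Ico_eq_sum_range]
    push_cast
    refine Finset.sum_congr rfl fun i _ => ?_
    ring
  rw [h1]
  calc ((harmonic (N - 1) : ℚ) : ℝ) ≤ 1 + Real.log ((N - 1 : ℕ) : ℝ) := harmonic_le_one_add_log _
    _ ≤ 1 + Real.log N := by
        have h0 : (0 : ℝ) < ((N - 1 : ℕ) : ℝ) := by exact_mod_cast (by omega : 0 < N - 1)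
        have hle : ((N - 1 : ℕ) : ℝ) ≤ N := by exact_mod_cast Nat.sub_le N 1
        linarith [Real.log_le_log h0 hle]

/-- `log⌈PT⁻²⌉ ≤ 1 + 𝓛⁹` (`P = exp 𝓛⁹`, `T ≥ 1`). [cite: Zhang2022LandauSiegel, §7 (7.2) p.33] -/
private theorem log_nsupp_le (D : ℕ) : Real.log (Skeleton.Nsupp D) ≤ 1 + Skeleton.ell D ^ 9 := by
  have hℓ0 : 0 ≤ Skeleton.ell D := Real.log_natCast_nonneg D
  have hP : 0 < Skeleton.bigP D := Real.exp_pos _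
  have hP1 : 1 ≤ Skeleton.bigP D := Real.one_le_exp (by positivity)
  have hT1 : 1 ≤ Skeleton.bigT D ^ 2 :=
    one_le_pow₀ (Real.one_le_exp (Real.rpow_nonneg hℓ0 _))
  have hN : (Skeleton.Nsupp D : ℝ) ≤ 2 * Skeleton.bigP D := by
    have h1 : (Skeleton.Nsupp D : ℝ) < Skeleton.bigP D / Skeleton.bigT D ^ 2 + 1 :=
      Nat.ceil_lt_add_one (by positivity)
    have h2 : Skeleton.bigP D / Skeleton.bigT D ^ 2 ≤ Skeleton.bigP D := div_le_self hP.le hT1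
    linarith
  rcases Nat.eq_zero_or_pos (Skeleton.Nsupp D) with h0 | hpos
  · rw [h0, Nat.cast_zero, Real.log_zero]
    positivity
  calc Real.log (Skeleton.Nsupp D) ≤ Real.log (2 * Skeleton.bigP D) :=
        Real.log_le_log (by exact_mod_cast hpos) hN
    _ = Real.log 2 + Skeleton.ell D ^ 9 := by
        rw [Real.log_mul (by norm_num) hP.ne', Skeleton.bigP, Real.log_exp]
    _ ≤ 1 + Skeleton.ell D ^ 9 := by linarith [Real.log_two_lt_d9]

/-- `p < 3P` on the window `p ∼ P` (`D ≥ 3`). [cite: Zhang2022LandauSiegel, §2 p.4] -/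
private theorem le_three_bigP_of_mem_primeWindow {D p : ℕ} (hD : 3 ≤ D)
    (hp : p ∈ Skeleton.primeWindow D) : (p : ℝ) ≤ 3 * Skeleton.bigP D := by
  have hlog : 1 ≤ Skeleton.ell D := by
    rw [Skeleton.ell]
    have h3 : (3 : ℝ) ≤ D := by exact_mod_cast hD
    calc (1 : ℝ) ≤ Real.log 3 := by
          rw [Real.le_log_iff_exp_le (by norm_num)]
          linarith [Real.exp_one_lt_d9]
      _ ≤ Real.log D := Real.log_le_log (by norm_num) h3
  have hP1 : 1 ≤ Skeleton.bigP D := Real.one_le_exp (by positivity)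
  have hℓ : (Skeleton.ell D ^ 68)⁻¹ ≤ 1 := inv_le_one_of_one_le₀ (one_le_pow₀ hlog)
  simp only [Skeleton.primeWindow, Finset.mem_filter, Finset.mem_Ioo] at hp
  have h0 : 0 ≤ Skeleton.bigP D * (1 + (Skeleton.ell D ^ 68)⁻¹) := by positivity
  have h1 : (p : ℝ) < Skeleton.bigP D * (1 + (Skeleton.ell D ^ 68)⁻¹) + 1 :=
    lt_of_le_of_lt (by exact_mod_cast hp.1.2.le) (Nat.ceil_lt_add_one h0)
  nlinarith [mul_le_mul_of_nonneg_left hℓ (zero_le_one.trans hP1)]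

/-- **Absorbing a power of `𝓛` into `ε₁ = exp{−c𝓛^{1/10}}` by halving `c`**: for every `K` and
`c₀ > 0`, `K(2 + 𝓛⁹)ε₁(c₀) ≤ ε₁(c₀/2)` for all large `D` (via `x⁹⁰/90! ≤ eˣ`, `𝓛⁹ = (𝓛^{1/10})⁹⁰`).
[cite: Zhang2022LandauSiegel, §7 p.40, tex L2127] -/
theorem absorb_log_eps1 (K c₀ : ℝ) (hc₀ : 0 < c₀) :
    ∃ D₁ : ℕ, ∀ D : ℕ, D₁ ≤ D → K * (2 + Skeleton.ell D ^ 9) * eps1 c₀ D ≤ eps1 (c₀ / 2) D := by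
  set A : ℝ := (Nat.factorial 90 : ℝ) * (4 / c₀) ^ 90 with hA
  set K' : ℝ := |K| * (2 + A) + 1 with hK'
  have hA0 : 0 ≤ A := by positivity
  have hK'1 : 1 ≤ K' := by
    have h0 : 0 ≤ |K| * (2 + A) := by positivity
    rw [hK']
    linarith
  set u₁ : ℝ := max (4 * Real.log K' / c₀) 0 with hu₁
  have hu₁0 : 0 ≤ u₁ := le_max_right _ _
  refine ⟨⌈Real.exp (u₁ ^ 10)⌉₊, fun D hD => ?_⟩
  have hexpD : Real.exp (u₁ ^ 10) ≤ D := (Nat.le_ceil _).trans (by exact_mod_cast hD)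
  have hDpos : (0 : ℝ) < D := lt_of_lt_of_le (Real.exp_pos _) hexpD
  have hℓ : u₁ ^ 10 ≤ Skeleton.ell D := (Real.le_log_iff_exp_le hDpos).mpr hexpD
  have hℓ0 : 0 ≤ Skeleton.ell D := le_trans (by positivity) hℓ
  set u : ℝ := Skeleton.ell D ^ ((1 : ℝ) / 10) with hu
  have hu0 : 0 ≤ u := Real.rpow_nonneg hℓ0 _
  have hu₁u : u₁ ≤ u := by
    have h := Real.rpow_le_rpow (by positivity) hℓ (by norm_num : (0 : ℝ) ≤ (1 : ℝ) / 10)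
    have h2 : (u₁ ^ 10) ^ ((1 : ℝ) / 10) = u₁ := by
      rw [show ((1 : ℝ) / 10) = ((10 : ℕ) : ℝ)⁻¹ by norm_num]
      exact Real.pow_rpow_inv_natCast hu₁0 (by norm_num)
    rwa [h2] at h
  have hℓ9 : Skeleton.ell D ^ 9 = u ^ 90 := by
    rw [hu, ← Real.rpow_mul_natCast hℓ0,
      show ((1 : ℝ) / 10 * ((90 : ℕ) : ℝ) : ℝ) = ((9 : ℕ) : ℝ) by norm_num, Real.rpow_natCast]
  -- `u⁹⁰ ≤ A·exp(c₀u/4)`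
  have hpow : u ^ 90 ≤ A * Real.exp (c₀ / 4 * u) := by
    have h := Real.pow_div_factorial_le_exp (c₀ / 4 * u) (by positivity) 90
    have h90 : u ^ 90 = (4 / c₀) ^ 90 * (c₀ / 4 * u) ^ 90 := by
      rw [← mul_pow]; congr 1; field_simp
    have hfac : (0 : ℝ) < Nat.factorial 90 := by positivity
    rw [h90, hA]
    calc (4 / c₀) ^ 90 * (c₀ / 4 * u) ^ 90
        = ((Nat.factorial 90 : ℝ) * (4 / c₀) ^ 90) * ((c₀ / 4 * u) ^ 90 / Nat.factorial 90) := by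
          field_simp
      _ ≤ ((Nat.factorial 90 : ℝ) * (4 / c₀) ^ 90) * Real.exp (c₀ / 4 * u) := by gcongr
  -- `K(2 + u⁹⁰) ≤ K'·exp(c₀u/4) ≤ exp(c₀u/2)`
  have hKle : K * (2 + u ^ 90) ≤ K' * Real.exp (c₀ / 4 * u) := by
    have hex1 : 1 ≤ Real.exp (c₀ / 4 * u) := Real.one_le_exp (by positivity)
    have h1 : K * (2 + u ^ 90) ≤ |K| * (2 + u ^ 90) :=
      mul_le_mul_of_nonneg_right (le_abs_self K) (by positivity)
    have h2 : |K| * (2 + u ^ 90) ≤ |K| * (2 + A * Real.exp (c₀ / 4 * u)) := by gcongr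
    have h3 : |K| * (2 + A * Real.exp (c₀ / 4 * u)) ≤ K' * Real.exp (c₀ / 4 * u) := by
      rw [hK']
      nlinarith [abs_nonneg K, hA0, hex1]
    linarith
  have hK'le : K' ≤ Real.exp (c₀ / 4 * u) := by
    have h1 : 4 * Real.log K' / c₀ ≤ u := (le_max_left _ _).trans hu₁u
    have h2 : Real.log K' ≤ c₀ / 4 * u := by
      have h := mul_le_mul_of_nonneg_left h1 (le_of_lt (by positivity : (0 : ℝ) < c₀ / 4))
      calc Real.log K' = c₀ / 4 * (4 * Real.log K' / c₀) := by field_simp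
        _ ≤ c₀ / 4 * u := h
    calc K' = Real.exp (Real.log K') := (Real.exp_log (by linarith)).symm
      _ ≤ Real.exp (c₀ / 4 * u) := Real.exp_le_exp.mpr h2
  have hfin : K * (2 + u ^ 90) * Real.exp (-(c₀ / 2 * u)) ≤ 1 := by
    have hE : K' * Real.exp (c₀ / 4 * u) ≤ Real.exp (c₀ / 4 * u) * Real.exp (c₀ / 4 * u) :=
      mul_le_mul_of_nonneg_right hK'le (Real.exp_pos _).le
    have h : K * (2 + u ^ 90) ≤ Real.exp (c₀ / 2 * u) := by
      calc K * (2 + u ^ 90) ≤ K' * Real.exp (c₀ / 4 * u) := hKle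
        _ ≤ Real.exp (c₀ / 4 * u) * Real.exp (c₀ / 4 * u) := hE
        _ = Real.exp (c₀ / 2 * u) := by rw [← Real.exp_add]; congr 1; ring
    calc K * (2 + u ^ 90) * Real.exp (-(c₀ / 2 * u))
        ≤ Real.exp (c₀ / 2 * u) * Real.exp (-(c₀ / 2 * u)) :=
          mul_le_mul_of_nonneg_right h (Real.exp_pos _).le
      _ = 1 := by rw [← Real.exp_add, add_neg_cancel, Real.exp_zero]
  have hε : eps1 c₀ D = eps1 (c₀ / 2) D * Real.exp (-(c₀ / 2 * u)) := by
    rw [eps1, eps1, ← Real.exp_add]; congr 1; rw [hu]; ring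
  have hε2 : 0 < eps1 (c₀ / 2) D := Real.exp_pos _
  rw [hε, hℓ9]
  calc K * (2 + u ^ 90) * (eps1 (c₀ / 2) D * Real.exp (-(c₀ / 2 * u)))
      = eps1 (c₀ / 2) D * (K * (2 + u ^ 90) * Real.exp (-(c₀ / 2 * u))) := by ring
    _ ≤ eps1 (c₀ / 2) D * 1 := mul_le_mul_of_nonneg_left hfin hε2.le
    _ = eps1 (c₀ / 2) D := mul_one _

/-! ## `Z22:§7.u052` from `Z22:§7.u049` -/

/-- **EDGE `Z22:§7.u049 ⇒ Z22:§7.u052` (kernel-checked).** "This yields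
`Σ_{(l₂,k)=1} a₁(d₂l₂) Σ_{(l₁,kd₂)=1} κ(d₁l₁)Δ(l₁l₂/(pk)) = Σ_{1≤j≤3} 𝔯ⱼ (pk)^{1−β_j} κ̃₀ⱼ(d₁;d₂k)
λ₀ⱼ(d₁d₂k) Σ_{(l,k)=1} a₁(d₂l) l^{−(1−β_j)} + O(Pkε₁)`" (§7 p. 41) from the termwise residue formula
`Step7u049` (§7 p. 40): multiply by `a₁(d₂l₂)` and sum over `l₂` (a finite sum, `d₂l₂ < PT⁻²` by
(7.2)); `(pk/l₂)^{1−β_j} = (pk)^{1−β_j} l₂^{−(1−β_j)}`; the error `Σ_{l₂} |a₁|·C·pkε₁/l₂ ≤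
3BC·Pkε₁·(2 + 𝓛⁹)` is `≤ Pk·ε₁(c/2)` for large `D` (`absorb_log_eps1`). The conclusion's constant in
`ε₁` is HALF the hypothesis' (both nodes quantify `∃ c > 0`). [cite: Zhang2022LandauSiegel, §7 p.41, tex L2131] -/
theorem ded7u052_of (c' : ℝ) (h49 : Step7u049 c') : Step7u052 c' := by
  intro B
  obtain ⟨c₀, hc₀, C₀, D₀, h49⟩ := h49
  obtain ⟨D₁, hD₁⟩ := absorb_log_eps1 (3 * |B| * |C₀|) c₀ hc₀
  refine ⟨c₀ / 2, by positivity, 1, max D₀ (max D₁ 3), ?_⟩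
  intro D _ χ hD hq hprim hA a₁ ha₁ p hp d₁ d₂ k hd₁ hd₂ hk hdk
  have hD₀ : D₀ ≤ D := le_trans (le_max_left _ _) hD
  have hD₁' : D₁ ≤ D := le_trans ((le_max_left _ _).trans (le_max_right _ _)) hD
  have hD3 : 3 ≤ D := le_trans ((le_max_right _ _).trans (le_max_right _ _)) hD
  have h49D := h49 D χ hD₀ hq hprim hA p hp
  set N := Skeleton.Nsupp D with hN
  set S := (Finset.Ico 1 N).filter (fun l => Nat.Coprime l k) with hS
  have hB0 : 0 ≤ B := le_trans (norm_nonneg _) (ha₁.1 0)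
  have hp0 : 0 < p := by
    have h := Finset.mem_filter.mp hp
    exact h.2.pos
  have hpk : 0 < (p : ℝ) * k := by
    have : (0 : ℝ) < p := by exact_mod_cast hp0
    have : (0 : ℝ) < k := by exact_mod_cast hk
    positivity
  have hε0 : 0 < eps1 c₀ D := Real.exp_pos _
  have hP0 : 0 < Skeleton.bigP D := Real.exp_pos _
  have hk0 : (0 : ℝ) < k := by exact_mod_cast hk
  -- support: `a₁(d₂ l) = 0` for `l ≥ N`
  have hsupp : ∀ l : ℕ, N ≤ l → a₁ (d₂ * l) = 0 := fun l hl =>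
    eq_zero_of_nsupp_le ha₁ (le_trans hl (Nat.le_mul_of_pos_left l hd₂))
  have hoff : ∀ (f : ℕ → ℂ) (l : ℕ), l ∉ S →
      (if 0 < l ∧ Nat.Coprime l k then a₁ (d₂ * l) * f l else 0) = 0 := by
    intro f l hl
    by_cases h : 0 < l ∧ Nat.Coprime l k
    · rw [if_pos h]
      have hNl : N ≤ l := le_of_not_gt fun hlt =>
        hl (by rw [hS, Finset.mem_filter, Finset.mem_Ico]; exact ⟨⟨h.1, hlt⟩, h.2⟩)
      rw [hsupp l hNl, zero_mul]
    · rw [if_neg h]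
  have hon : ∀ (f : ℕ → ℂ), ∀ l ∈ S,
      (if 0 < l ∧ Nat.Coprime l k then a₁ (d₂ * l) * f l else 0) = a₁ (d₂ * l) * f l := by
    intro f l hl
    rw [hS, Finset.mem_filter, Finset.mem_Ico] at hl
    rw [if_pos ⟨hl.1.1, hl.2⟩]
  -- (1) the `l₂`-series of the left side is a finite sum over `S`
  have hT1 : (∑' l₂ : ℕ, if 0 < l₂ ∧ Nat.Coprime l₂ k then
        a₁ (d₂ * l₂) * innerDeltaSum c' D d₁ (d₂ * k) ((l₂ : ℝ) / ((p : ℝ) * k)) else 0) =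
      ∑ l₂ ∈ S, a₁ (d₂ * l₂) * innerDeltaSum c' D d₁ (d₂ * k) ((l₂ : ℝ) / ((p : ℝ) * k)) := by
    rw [tsum_eq_sum (s := S)
      (hoff (fun l₂ => innerDeltaSum c' D d₁ (d₂ * k) ((l₂ : ℝ) / ((p : ℝ) * k))))]
    exact Finset.sum_congr rfl
      (hon (fun l₂ => innerDeltaSum c' D d₁ (d₂ * k) ((l₂ : ℝ) / ((p : ℝ) * k))))
  -- (2) the `l`-series of the right side, for each `j`
  have hT2 : ∀ j : ℕ, (∑' l : ℕ, if 0 < l ∧ Nat.Coprime l k then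
        a₁ (d₂ * l) / (l : ℂ) ^ (1 - Skeleton.betaJ c' D j) else 0) =
      ∑ l ∈ S, a₁ (d₂ * l) / (l : ℂ) ^ (1 - Skeleton.betaJ c' D j) := by
    intro j
    have hoff' := hoff (fun l => ((l : ℂ) ^ (1 - Skeleton.betaJ c' D j))⁻¹)
    have hon' := hon (fun l => ((l : ℂ) ^ (1 - Skeleton.betaJ c' D j))⁻¹)
    simp only [← div_eq_mul_inv] at hoff' hon'
    rw [tsum_eq_sum (s := S) hoff']
    exact Finset.sum_congr rfl hon'
  -- (3) the two main terms agree: `(pk/l₂)^{1−β} = (pk)^{1−β}/l₂^{1−β}`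
  have hM : (∑ j ∈ Finset.Icc 1 3,
      frakr c' D j * ((((p : ℝ) * k : ℝ) : ℂ) ^ (1 - Skeleton.betaJ c' D j)) *
          Skeleton.kappaTildeZero c' D j d₁ (d₂ * k) * Skeleton.lamZero c' D j (d₁ * d₂ * k) *
        ∑ l ∈ S, a₁ (d₂ * l) / (l : ℂ) ^ (1 - Skeleton.betaJ c' D j)) =
      ∑ l₂ ∈ S, a₁ (d₂ * l₂) * ∑ j ∈ Finset.Icc 1 3,
        frakr c' D j * Skeleton.kappaTildeZero c' D j d₁ (d₂ * k) *
            Skeleton.lamZero c' D j (d₁ * d₂ * k) *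
          ((((p : ℝ) * k) / l₂ : ℝ) : ℂ) ^ (1 - Skeleton.betaJ c' D j) := by
    simp only [Finset.mul_sum]
    rw [Finset.sum_comm]
    refine Finset.sum_congr rfl fun l₂ hl₂ => Finset.sum_congr rfl fun j _ => ?_
    have hl₂pos : 0 < (l₂ : ℝ) := by
      rw [hS, Finset.mem_filter, Finset.mem_Ico] at hl₂
      exact_mod_cast hl₂.1.1
    rw [ofReal_div_cpow hpk hl₂pos, Complex.ofReal_natCast]
    ring
  -- (4) the error, term by term
  have key : ‖(∑ l₂ ∈ S, a₁ (d₂ * l₂) * innerDeltaSum c' D d₁ (d₂ * k) ((l₂ : ℝ) / ((p : ℝ) * k))) -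
      ∑ l₂ ∈ S, a₁ (d₂ * l₂) * ∑ j ∈ Finset.Icc 1 3,
        frakr c' D j * Skeleton.kappaTildeZero c' D j d₁ (d₂ * k) *
            Skeleton.lamZero c' D j (d₁ * d₂ * k) *
          ((((p : ℝ) * k) / l₂ : ℝ) : ℂ) ^ (1 - Skeleton.betaJ c' D j)‖ ≤
      B * |C₀| * ((p : ℝ) * k * eps1 c₀ D) * ∑ l₂ ∈ S, 1 / (l₂ : ℝ) := by
    rw [← Finset.sum_sub_distrib, Finset.mul_sum]
    refine (norm_sum_le _ _).trans (Finset.sum_le_sum fun l₂ hl₂ => ?_)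
    rw [hS, Finset.mem_filter, Finset.mem_Ico] at hl₂
    rw [← mul_sub, norm_mul]
    have hl₂pos : (0 : ℝ) < l₂ := by exact_mod_cast hl₂.1.1
    by_cases hlt : ((d₂ * l₂ : ℕ) : ℝ) < Skeleton.bigP D / Skeleton.bigT D ^ 2
    · have h := h49D d₁ d₂ k l₂ hd₁ hd₂ hk hl₂.1.1 hlt hdk
      have hC : C₀ * ((p : ℝ) * k * eps1 c₀ D / l₂) ≤ |C₀| * ((p : ℝ) * k * eps1 c₀ D / l₂) :=
        mul_le_mul_of_nonneg_right (le_abs_self _) (by positivity)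
      calc ‖a₁ (d₂ * l₂)‖ * ‖innerDeltaSum c' D d₁ (d₂ * k) ((l₂ : ℝ) / ((p : ℝ) * k)) -
              ∑ j ∈ Finset.Icc 1 3,
                frakr c' D j * Skeleton.kappaTildeZero c' D j d₁ (d₂ * k) *
                    Skeleton.lamZero c' D j (d₁ * d₂ * k) *
                  ((((p : ℝ) * k) / l₂ : ℝ) : ℂ) ^ (1 - Skeleton.betaJ c' D j)‖
          ≤ B * (|C₀| * ((p : ℝ) * k * eps1 c₀ D / l₂)) :=
            mul_le_mul (ha₁.1 _) (h.trans hC) (norm_nonneg _) hB0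
        _ = B * |C₀| * ((p : ℝ) * k * eps1 c₀ D) * (1 / (l₂ : ℝ)) := by ring
    · have hz : a₁ (d₂ * l₂) = 0 := ha₁.2 _ (not_lt.mp hlt)
      rw [hz, norm_zero, zero_mul]
      positivity
  -- (5) assemble
  rw [hT1]
  simp_rw [hT2]
  rw [hM]
  refine key.trans ?_
  have hharm : ∑ l₂ ∈ S, 1 / (l₂ : ℝ) ≤ 2 + Skeleton.ell D ^ 9 := by
    calc ∑ l₂ ∈ S, 1 / (l₂ : ℝ) ≤ ∑ l₂ ∈ Finset.Ico 1 N, 1 / (l₂ : ℝ) :=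
          Finset.sum_le_sum_of_subset_of_nonneg (Finset.filter_subset _ _)
            (fun _ _ _ => by positivity)
      _ ≤ 1 + Real.log N := sum_Ico_inv_le_log N
      _ ≤ 2 + Skeleton.ell D ^ 9 := by linarith [log_nsupp_le D]
  have hp3 : (p : ℝ) ≤ 3 * Skeleton.bigP D := le_three_bigP_of_mem_primeWindow hD3 hp
  have habs := hD₁ D hD₁'
  rw [abs_of_nonneg hB0] at habs
  have hℓ9 : 0 ≤ 2 + Skeleton.ell D ^ 9 := by
    have : 0 ≤ Skeleton.ell D := Real.log_natCast_nonneg D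
    positivity
  calc B * |C₀| * ((p : ℝ) * k * eps1 c₀ D) * ∑ l₂ ∈ S, 1 / (l₂ : ℝ)
      ≤ B * |C₀| * ((3 * Skeleton.bigP D) * k * eps1 c₀ D) * (2 + Skeleton.ell D ^ 9) := by
        gcongr
    _ = Skeleton.bigP D * k * (3 * B * |C₀| * (2 + Skeleton.ell D ^ 9) * eps1 c₀ D) := by ring
    _ ≤ Skeleton.bigP D * k * eps1 (c₀ / 2) D := mul_le_mul_of_nonneg_left habs (by positivity)
    _ = 1 * (Skeleton.bigP D * k * eps1 (c₀ / 2) D) := (one_mul _).symm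


/-! ## (7.20) from (7.18) and `Z22:§7.u052` -/

/-- `Σ_{1≤k<⌈PT⁻²⌉} 1/φ(k) ≤ 12(2 + 𝓛⁹)` (from `Montgomery.sum_Icc_inv_totient_le`).
[cite: Zhang2022LandauSiegel, §7 (7.2) p.33] -/
private theorem sum_Ico_inv_totient_le (D : ℕ) :
    ∑ k ∈ Finset.Ico 1 (Skeleton.Nsupp D), 1 / (Nat.totient k : ℝ) ≤
      12 * (2 + Skeleton.ell D ^ 9) := by
  have hℓ0 : 0 ≤ Skeleton.ell D := Real.log_natCast_nonneg D
  rcases Nat.eq_zero_or_pos (Skeleton.Nsupp D) with h0 | hN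
  · rw [h0]
    simp only [show Finset.Ico 1 0 = ∅ by rfl, Finset.sum_empty]
    positivity
  have hIco : Finset.Ico 1 (Skeleton.Nsupp D) = Finset.Icc 1 (Skeleton.Nsupp D - 1) := by
    ext k
    simp only [Finset.mem_Ico, Finset.mem_Icc]
    omega
  rw [hIco]
  have h1 := Montgomery.sum_Icc_inv_totient_le (Skeleton.Nsupp D - 1)
  have hlog : Real.log ((Skeleton.Nsupp D - 1 : ℕ) : ℝ) ≤ 1 + Skeleton.ell D ^ 9 := by
    rcases Nat.eq_zero_or_pos (Skeleton.Nsupp D - 1) with h | h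
    · rw [h, Nat.cast_zero, Real.log_zero]
      positivity
    · calc Real.log ((Skeleton.Nsupp D - 1 : ℕ) : ℝ) ≤ Real.log (Skeleton.Nsupp D) :=
            Real.log_le_log (by exact_mod_cast h) (by exact_mod_cast Nat.sub_le _ 1)
        _ ≤ 1 + Skeleton.ell D ^ 9 := log_nsupp_le D
  linarith

/-- The weight `a₂(n)μ(k)/(kφ(k))` of (7.18) is at most `B/(kφ(k))` in norm.
[cite: Zhang2022LandauSiegel, §7 (7.18) p.39] -/
private theorem norm_weight_le {D : ℕ} {B : ℝ} {a₂ : ℕ → ℂ} (ha₂ : Skeleton.Adm72 D B a₂)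
    (n k : ℕ) (hk : 0 < k) :
    ‖a₂ n * (μ k : ℂ) / ((k : ℂ) * (Nat.totient k : ℂ))‖ ≤ B / ((k : ℝ) * Nat.totient k) := by
  have hB : ‖a₂ n‖ ≤ B := ha₂.1 n
  have hμ : ‖(μ k : ℂ)‖ ≤ 1 := by
    rw [Complex.norm_intCast]
    exact_mod_cast ArithmeticFunction.abs_moebius_le_one
  have hφ : 0 < Nat.totient k := Nat.totient_pos.mpr hk
  have hkφ : (0 : ℝ) ≤ (k : ℝ) * Nat.totient k := by positivity
  rw [norm_div, norm_mul, norm_mul, Complex.norm_natCast, Complex.norm_natCast]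
  refine div_le_div_of_nonneg_right ?_ hkφ
  calc ‖a₂ n‖ * ‖(μ k : ℂ)‖ ≤ B * 1 :=
        mul_le_mul hB hμ (norm_nonneg _) (le_trans (norm_nonneg _) hB)
    _ = B := mul_one B

/-- Reordering a four-fold sum: `(d₁, d₂, k, j) ↦ (j, d₂, d₁, k)`. [folklore] -/
private theorem sum4_reorder (I J : Finset ℕ) (G : ℕ → ℕ → ℕ → ℕ → ℂ) :
    ∑ d₁ ∈ I, ∑ d₂ ∈ I, ∑ k ∈ I, ∑ j ∈ J, G d₁ d₂ k j =
      ∑ j ∈ J, ∑ d₂ ∈ I, ∑ d₁ ∈ I, ∑ k ∈ I, G d₁ d₂ k j := by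
  calc ∑ d₁ ∈ I, ∑ d₂ ∈ I, ∑ k ∈ I, ∑ j ∈ J, G d₁ d₂ k j
      = ∑ d₂ ∈ I, ∑ d₁ ∈ I, ∑ k ∈ I, ∑ j ∈ J, G d₁ d₂ k j := Finset.sum_comm
    _ = ∑ d₂ ∈ I, ∑ d₁ ∈ I, ∑ j ∈ J, ∑ k ∈ I, G d₁ d₂ k j := by
        refine Finset.sum_congr rfl fun d₂ _ => Finset.sum_congr rfl fun d₁ _ => ?_
        exact Finset.sum_comm
    _ = ∑ d₂ ∈ I, ∑ j ∈ J, ∑ d₁ ∈ I, ∑ k ∈ I, G d₁ d₂ k j := by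
        refine Finset.sum_congr rfl fun d₂ _ => ?_
        exact Finset.sum_comm
    _ = ∑ j ∈ J, ∑ d₂ ∈ I, ∑ d₁ ∈ I, ∑ k ∈ I, G d₁ d₂ k j := Finset.sum_comm

/-- **EDGE `(7.18) ∧ Z22:§7.u052 ⇒ (7.20)` (kernel-checked).** "Inserting this into (7.18) and
rearranging the terms we obtain `𝔗₁₁(p) = Σ_{1≤j≤3} 𝔯ⱼ p^{1−β_j} S*ⱼ(𝐚₁,𝐚₂) + O(Pε₁)` (7.20)"
(§7 p. 41): substitute `Step7u052` into the right side of (7.18) (`Eq718`), recognise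
`S*ⱼ(𝐚₁,𝐚₂)` (`SjStar`: `(pk)^{1−β_j}μ(k)/(d₁d₂kφ(k)) = p^{1−β_j}μ(k)/(d₁d₂φ(k)k^{β_j})`, the
`l`-series being the finite coprime sum by (7.2)), and bound the accumulated error by
`B·C·Pε₁·(Σ_{d<PT⁻²} d⁻¹)²·Σ_{k<PT⁻²} φ(k)⁻¹ ≤ 12BC·Pε₁(c)(2 + 𝓛⁹)³ ≤ P·ε₁(c/8)` for large `D`
(`absorb_log_eps1` three times; the conclusion's `ε₁`-constant is one eighth of the hypothesis').
The support clause "we can assume `d₂l₂ < PT⁻²`, `d₁d₂k < PT⁻²`" (`Z22:§7.u044`) is used through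
`Skeleton.Adm72` directly. [cite: Zhang2022LandauSiegel, §7 (7.20) p.41, tex L2138] -/
theorem eq720_of (c' : ℝ) (h718 : Eq718 c') (h52 : Step7u052 c') : Eq720 c' := by
  intro B
  obtain ⟨D₂, h718⟩ := h718 B
  obtain ⟨c₁, hc₁, C₁, D₀, h52⟩ := h52 B
  obtain ⟨D₁, hD₁⟩ := absorb_log_eps1 (12 * |B| * |C₁|) c₁ hc₁
  obtain ⟨D₁', hD₁'⟩ := absorb_log_eps1 1 (c₁ / 2) (by positivity)
  obtain ⟨D₁'', hD₁''⟩ := absorb_log_eps1 1 (c₁ / 2 / 2) (by positivity)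
  refine ⟨c₁ / 2 / 2 / 2, by positivity, 1,
    max (max D₀ D₂) (max (max D₁ D₁') (max D₁'' 3)), ?_⟩
  intro D _ χ hD hq hprim hA a₁ a₂ ha₁ ha₂ p hp
  have hD₀ : D₀ ≤ D := le_trans ((le_max_left _ _).trans (le_max_left _ _)) hD
  have hD₂ : D₂ ≤ D := le_trans ((le_max_right _ _).trans (le_max_left _ _)) hD
  have hD₁D : D₁ ≤ D :=
    le_trans ((le_max_left _ _).trans ((le_max_left _ _).trans (le_max_right _ _))) hD
  have hD₁'D : D₁' ≤ D :=
    le_trans ((le_max_right _ _).trans ((le_max_left _ _).trans (le_max_right _ _))) hD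
  have hD₁''D : D₁'' ≤ D :=
    le_trans ((le_max_left _ _).trans ((le_max_right _ _).trans (le_max_right _ _))) hD
  have h52D := h52 D χ hD₀ hq hprim hA a₁ ha₁ p hp
  rw [h718 D χ hD₂ hq hprim hA a₁ a₂ ha₁ ha₂ p hp]
  -- positivity facts
  have hB0 : 0 ≤ B := le_trans (norm_nonneg _) (ha₁.1 0)
  have hp0 : 0 < p := (Finset.mem_filter.mp hp).2.pos
  have hpR : (0 : ℝ) < p := by exact_mod_cast hp0
  have hpC : (p : ℂ) ≠ 0 := by exact_mod_cast hp0.ne'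
  have hε0 : 0 < eps1 c₁ D := Real.exp_pos _
  have hP0 : 0 < Skeleton.bigP D := Real.exp_pos _
  have hℓ9 : 0 ≤ 2 + Skeleton.ell D ^ 9 := by
    have : 0 ≤ Skeleton.ell D := Real.log_natCast_nonneg D
    positivity
  -- abbreviations
  set T : ℕ → ℕ → ℕ → ℂ := fun d₁ d₂ k => ∑' l₂ : ℕ, if 0 < l₂ ∧ Nat.Coprime l₂ k then
      a₁ (d₂ * l₂) * innerDeltaSum c' D d₁ (d₂ * k) ((l₂ : ℝ) / ((p : ℝ) * k)) else 0 with hT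
  set M : ℕ → ℕ → ℕ → ℂ := fun d₁ d₂ k => ∑ j ∈ Finset.Icc 1 3,
      frakr c' D j * ((((p : ℝ) * k : ℝ) : ℂ) ^ (1 - Skeleton.betaJ c' D j)) *
          Skeleton.kappaTildeZero c' D j d₁ (d₂ * k) * Skeleton.lamZero c' D j (d₁ * d₂ * k) *
        ∑' l : ℕ, if 0 < l ∧ Nat.Coprime l k then
          a₁ (d₂ * l) / (l : ℂ) ^ (1 - Skeleton.betaJ c' D j) else 0 with hM
  set w : ℕ → ℕ → ℕ → ℂ := fun d₁ d₂ k =>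
      a₂ (d₁ * d₂ * k) * (μ k : ℂ) / ((k : ℂ) * (Nat.totient k : ℂ)) with hw
  set F : ℕ → ℕ → ℕ → ℂ := fun j d k =>
      ∑ l ∈ (Finset.Ico 1 (Skeleton.Nsupp D)).filter (fun l => Nat.Coprime l k),
        a₁ (d * l) / (l : ℂ) ^ (1 - Skeleton.betaJ c' D j) with hF
  change ‖(∑ d₁ ∈ Finset.Ico 1 (Skeleton.Nsupp D), ∑ d₂ ∈ Finset.Ico 1 (Skeleton.Nsupp D),
      ((d₁ : ℂ) * d₂)⁻¹ * ∑ k ∈ Finset.Ico 1 (Skeleton.Nsupp D), w d₁ d₂ k * T d₁ d₂ k) -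
      ∑ j ∈ Finset.Icc 1 3, frakr c' D j * (p : ℂ) ^ (1 - Skeleton.betaJ c' D j) *
        SjStar c' D j a₁ a₂‖ ≤ 1 * (Skeleton.bigP D * eps1 (c₁ / 2 / 2 / 2) D)
  -- (1) the `l`-series is the finite coprime sum
  have hT2 : ∀ j d₂ k : ℕ, 0 < d₂ → (∑' l : ℕ, if 0 < l ∧ Nat.Coprime l k then
      a₁ (d₂ * l) / (l : ℂ) ^ (1 - Skeleton.betaJ c' D j) else 0) = F j d₂ k := by
    intro j d₂ k hd₂
    simp only [hF]
    rw [tsum_eq_sum (s := Finset.Ico 1 (Skeleton.Nsupp D)) ?_, Finset.sum_filter]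
    · refine Finset.sum_congr rfl fun l hl => ?_
      have hl1 : 0 < l := (Finset.mem_Ico.mp hl).1
      by_cases hc : Nat.Coprime l k
      · rw [if_pos ⟨hl1, hc⟩, if_pos hc]
      · rw [if_neg (fun h => hc h.2), if_neg hc]
    · intro l hl
      by_cases h : 0 < l ∧ Nat.Coprime l k
      · have hNl : Skeleton.Nsupp D ≤ l :=
          le_of_not_gt fun hlt => hl (Finset.mem_Ico.mpr ⟨h.1, hlt⟩)
        rw [if_pos h, eq_zero_of_nsupp_le ha₁ (le_trans hNl (Nat.le_mul_of_pos_left l hd₂)),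
          zero_div]
      · rw [if_neg h]
  -- (2) `S*ⱼ` in terms of `F`
  have hSj : ∀ j : ℕ, SjStar c' D j a₁ a₂ =
      ∑ d ∈ Finset.Ico 1 (Skeleton.Nsupp D), ∑ d₁ ∈ Finset.Ico 1 (Skeleton.Nsupp D),
        ∑ k ∈ Finset.Ico 1 (Skeleton.Nsupp D),
          a₂ (d₁ * d * k) * Skeleton.kappaTildeZero c' D j d₁ (d * k) *
                Skeleton.lamZero c' D j (d₁ * d * k) * (μ k : ℂ) /
              ((d₁ : ℂ) * d * (Nat.totient k : ℂ) * (k : ℂ) ^ Skeleton.betaJ c' D j) *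
            F j d k := by
    intro j
    simp only [hF, SjStar]
  -- (3) the main terms agree
  have hmain : (∑ d₁ ∈ Finset.Ico 1 (Skeleton.Nsupp D), ∑ d₂ ∈ Finset.Ico 1 (Skeleton.Nsupp D),
      ((d₁ : ℂ) * d₂)⁻¹ * ∑ k ∈ Finset.Ico 1 (Skeleton.Nsupp D), w d₁ d₂ k *
        ∑ j ∈ Finset.Icc 1 3,
          frakr c' D j * ((((p : ℝ) * k : ℝ) : ℂ) ^ (1 - Skeleton.betaJ c' D j)) *
              Skeleton.kappaTildeZero c' D j d₁ (d₂ * k) *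
            Skeleton.lamZero c' D j (d₁ * d₂ * k) * F j d₂ k) =
      ∑ j ∈ Finset.Icc 1 3, frakr c' D j * (p : ℂ) ^ (1 - Skeleton.betaJ c' D j) *
        SjStar c' D j a₁ a₂ := by
    simp only [hSj, Finset.mul_sum]
    rw [sum4_reorder]
    refine Finset.sum_congr rfl fun j _ => Finset.sum_congr rfl fun d₂ hd₂ =>
      Finset.sum_congr rfl fun d₁ hd₁ => Finset.sum_congr rfl fun k hk => ?_
    have hk0 : 0 < k := (Finset.mem_Ico.mp hk).1
    have hd₁0 : 0 < d₁ := (Finset.mem_Ico.mp hd₁).1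
    have hd₂0 : 0 < d₂ := (Finset.mem_Ico.mp hd₂).1
    have hkC : (k : ℂ) ≠ 0 := by exact_mod_cast hk0.ne'
    have hd₁C : (d₁ : ℂ) ≠ 0 := by exact_mod_cast hd₁0.ne'
    have hd₂C : (d₂ : ℂ) ≠ 0 := by exact_mod_cast hd₂0.ne'
    have hφC : (Nat.totient k : ℂ) ≠ 0 := by exact_mod_cast (Nat.totient_pos.mpr hk0).ne'
    have hkβ : (k : ℂ) ^ Skeleton.betaJ c' D j ≠ 0 := by
      rw [cpow_def_of_ne_zero hkC]; exact Complex.exp_ne_zero _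
    have hpow : ((((p : ℝ) * k : ℝ)) : ℂ) ^ (1 - Skeleton.betaJ c' D j) =
        (p : ℂ) ^ (1 - Skeleton.betaJ c' D j) * ((k : ℂ) / (k : ℂ) ^ Skeleton.betaJ c' D j) := by
      push_cast
      rw [Complex.natCast_mul_natCast_cpow, Complex.cpow_sub _ _ hkC, Complex.cpow_one]
    simp only [hw, hpow]
    field_simp
  -- (4) the main term with the series, and the split of the difference
  have hMeq : (∑ d₁ ∈ Finset.Ico 1 (Skeleton.Nsupp D), ∑ d₂ ∈ Finset.Ico 1 (Skeleton.Nsupp D),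
      ((d₁ : ℂ) * d₂)⁻¹ * ∑ k ∈ Finset.Ico 1 (Skeleton.Nsupp D), w d₁ d₂ k * M d₁ d₂ k) =
      ∑ j ∈ Finset.Icc 1 3, frakr c' D j * (p : ℂ) ^ (1 - Skeleton.betaJ c' D j) *
        SjStar c' D j a₁ a₂ := by
    rw [← hmain]
    refine Finset.sum_congr rfl fun d₁ _ => Finset.sum_congr rfl fun d₂ hd₂ => ?_
    congr 1
    refine Finset.sum_congr rfl fun k _ => ?_
    congr 1
    simp only [hM]
    refine Finset.sum_congr rfl fun j _ => ?_
    rw [hT2 j d₂ k (Finset.mem_Ico.mp hd₂).1]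
  have hsplit : (∑ d₁ ∈ Finset.Ico 1 (Skeleton.Nsupp D), ∑ d₂ ∈ Finset.Ico 1 (Skeleton.Nsupp D),
      ((d₁ : ℂ) * d₂)⁻¹ * ∑ k ∈ Finset.Ico 1 (Skeleton.Nsupp D), w d₁ d₂ k * T d₁ d₂ k) -
      (∑ d₁ ∈ Finset.Ico 1 (Skeleton.Nsupp D), ∑ d₂ ∈ Finset.Ico 1 (Skeleton.Nsupp D),
      ((d₁ : ℂ) * d₂)⁻¹ * ∑ k ∈ Finset.Ico 1 (Skeleton.Nsupp D), w d₁ d₂ k * M d₁ d₂ k) =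
      ∑ d₁ ∈ Finset.Ico 1 (Skeleton.Nsupp D), ∑ d₂ ∈ Finset.Ico 1 (Skeleton.Nsupp D),
        ((d₁ : ℂ) * d₂)⁻¹ * ∑ k ∈ Finset.Ico 1 (Skeleton.Nsupp D),
          w d₁ d₂ k * (T d₁ d₂ k - M d₁ d₂ k) := by
    simp only [mul_sub, Finset.sum_sub_distrib]
  -- (5) the termwise error bound
  have hterm : ∀ d₁ ∈ Finset.Ico 1 (Skeleton.Nsupp D), ∀ d₂ ∈ Finset.Ico 1 (Skeleton.Nsupp D),
      ∀ k ∈ Finset.Ico 1 (Skeleton.Nsupp D),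
        ‖((d₁ : ℂ) * d₂)⁻¹ * (w d₁ d₂ k * (T d₁ d₂ k - M d₁ d₂ k))‖ ≤
          B * |C₁| * Skeleton.bigP D * eps1 c₁ D *
            (1 / (d₁ : ℝ)) * (1 / (d₂ : ℝ)) * (1 / (Nat.totient k : ℝ)) := by
    intro d₁ hd₁ d₂ hd₂ k hk
    have hd₁0 : 0 < d₁ := (Finset.mem_Ico.mp hd₁).1
    have hd₂0 : 0 < d₂ := (Finset.mem_Ico.mp hd₂).1
    have hk0 : 0 < k := (Finset.mem_Ico.mp hk).1
    have hφ0 : 0 < Nat.totient k := Nat.totient_pos.mpr hk0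
    have hd₁R : (0 : ℝ) < d₁ := by exact_mod_cast hd₁0
    have hd₂R : (0 : ℝ) < d₂ := by exact_mod_cast hd₂0
    have hkR : (0 : ℝ) < k := by exact_mod_cast hk0
    have hφR : (0 : ℝ) < Nat.totient k := by exact_mod_cast hφ0
    have hinv : ‖((d₁ : ℂ) * d₂)⁻¹‖ = 1 / ((d₁ : ℝ) * d₂) := by
      rw [norm_inv, norm_mul, Complex.norm_natCast, Complex.norm_natCast, one_div]
    rw [norm_mul, norm_mul, hinv]
    by_cases hlt : ((d₁ * d₂ * k : ℕ) : ℝ) < Skeleton.bigP D / Skeleton.bigT D ^ 2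
    · have h := h52D d₁ d₂ k hd₁0 hd₂0 hk0 hlt
      change ‖T d₁ d₂ k - M d₁ d₂ k‖ ≤ C₁ * (Skeleton.bigP D * k * eps1 c₁ D) at h
      have hC : C₁ * (Skeleton.bigP D * k * eps1 c₁ D) ≤ |C₁| * (Skeleton.bigP D * k * eps1 c₁ D) :=
        mul_le_mul_of_nonneg_right (le_abs_self _) (by positivity)
      have hwB := norm_weight_le ha₂ (d₁ * d₂ * k) k hk0
      calc 1 / ((d₁ : ℝ) * d₂) * (‖w d₁ d₂ k‖ * ‖T d₁ d₂ k - M d₁ d₂ k‖)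
          ≤ 1 / ((d₁ : ℝ) * d₂) * (B / ((k : ℝ) * Nat.totient k) *
              (|C₁| * (Skeleton.bigP D * k * eps1 c₁ D))) := by
            refine mul_le_mul_of_nonneg_left ?_ (by positivity)
            exact mul_le_mul hwB (h.trans hC) (norm_nonneg _) (by positivity)
        _ = B * |C₁| * Skeleton.bigP D * eps1 c₁ D *
              (1 / (d₁ : ℝ)) * (1 / (d₂ : ℝ)) * (1 / (Nat.totient k : ℝ)) := by
            field_simp
    · have hz : a₂ (d₁ * d₂ * k) = 0 := ha₂.2 _ (not_lt.mp hlt)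
      have hw0 : w d₁ d₂ k = 0 := by simp only [hw, hz, zero_mul, zero_div]
      rw [hw0, norm_zero, zero_mul, mul_zero]
      positivity
  -- (6) assemble
  rw [← hMeq, hsplit]
  have hsum1 : ∑ d ∈ Finset.Ico 1 (Skeleton.Nsupp D), 1 / (d : ℝ) ≤ 2 + Skeleton.ell D ^ 9 := by
    linarith [sum_Ico_inv_le_log (Skeleton.Nsupp D), log_nsupp_le D]
  have hsumφ := sum_Ico_inv_totient_le D
  have hs0 : 0 ≤ ∑ d ∈ Finset.Ico 1 (Skeleton.Nsupp D), 1 / (d : ℝ) :=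
    Finset.sum_nonneg fun d _ => by positivity
  have hφs0 : 0 ≤ ∑ k ∈ Finset.Ico 1 (Skeleton.Nsupp D), 1 / (Nat.totient k : ℝ) :=
    Finset.sum_nonneg fun k _ => by positivity
  calc ‖∑ d₁ ∈ Finset.Ico 1 (Skeleton.Nsupp D), ∑ d₂ ∈ Finset.Ico 1 (Skeleton.Nsupp D),
        ((d₁ : ℂ) * d₂)⁻¹ * ∑ k ∈ Finset.Ico 1 (Skeleton.Nsupp D),
          w d₁ d₂ k * (T d₁ d₂ k - M d₁ d₂ k)‖
      ≤ ∑ d₁ ∈ Finset.Ico 1 (Skeleton.Nsupp D), ∑ d₂ ∈ Finset.Ico 1 (Skeleton.Nsupp D),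
          ∑ k ∈ Finset.Ico 1 (Skeleton.Nsupp D),
            B * |C₁| * Skeleton.bigP D * eps1 c₁ D *
              (1 / (d₁ : ℝ)) * (1 / (d₂ : ℝ)) * (1 / (Nat.totient k : ℝ)) := by
        refine (norm_sum_le _ _).trans (Finset.sum_le_sum fun d₁ hd₁ => ?_)
        refine (norm_sum_le _ _).trans (Finset.sum_le_sum fun d₂ hd₂ => ?_)
        rw [Finset.mul_sum]
        refine (norm_sum_le _ _).trans (Finset.sum_le_sum fun k hk => ?_)
        exact hterm d₁ hd₁ d₂ hd₂ k hk
    _ = B * |C₁| * Skeleton.bigP D * eps1 c₁ D *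
          ((∑ d₁ ∈ Finset.Ico 1 (Skeleton.Nsupp D), 1 / (d₁ : ℝ)) *
            ((∑ d₂ ∈ Finset.Ico 1 (Skeleton.Nsupp D), 1 / (d₂ : ℝ)) *
              ∑ k ∈ Finset.Ico 1 (Skeleton.Nsupp D), 1 / (Nat.totient k : ℝ))) := by
        rw [Finset.sum_mul_sum, Finset.sum_mul_sum, Finset.mul_sum]
        refine Finset.sum_congr rfl fun d₁ _ => ?_
        rw [Finset.mul_sum]
        refine Finset.sum_congr rfl fun d₂ _ => ?_
        rw [Finset.mul_sum, Finset.mul_sum]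
        refine Finset.sum_congr rfl fun k _ => ?_
        ring
    _ ≤ B * |C₁| * Skeleton.bigP D * eps1 c₁ D *
          ((2 + Skeleton.ell D ^ 9) * ((2 + Skeleton.ell D ^ 9) * (12 * (2 + Skeleton.ell D ^ 9)))) := by
        gcongr
    _ = Skeleton.bigP D * ((2 + Skeleton.ell D ^ 9) * ((2 + Skeleton.ell D ^ 9) *
          (12 * B * |C₁| * (2 + Skeleton.ell D ^ 9) * eps1 c₁ D))) := by ring
    _ ≤ Skeleton.bigP D * eps1 (c₁ / 2 / 2 / 2) D := by
        refine mul_le_mul_of_nonneg_left ?_ hP0.le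
        have h1 := hD₁ D hD₁D
        rw [abs_of_nonneg hB0] at h1
        have h2 := hD₁' D hD₁'D
        have h3 := hD₁'' D hD₁''D
        calc (2 + Skeleton.ell D ^ 9) * ((2 + Skeleton.ell D ^ 9) *
              (12 * B * |C₁| * (2 + Skeleton.ell D ^ 9) * eps1 c₁ D))
            ≤ (2 + Skeleton.ell D ^ 9) * ((2 + Skeleton.ell D ^ 9) * eps1 (c₁ / 2) D) := by
              gcongr
          _ = (2 + Skeleton.ell D ^ 9) * (1 * (2 + Skeleton.ell D ^ 9) * eps1 (c₁ / 2) D) := by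
              ring
          _ ≤ (2 + Skeleton.ell D ^ 9) * eps1 (c₁ / 2 / 2) D :=
              mul_le_mul_of_nonneg_left h2 hℓ9
          _ = 1 * (2 + Skeleton.ell D ^ 9) * eps1 (c₁ / 2 / 2) D := by ring
          _ ≤ eps1 (c₁ / 2 / 2 / 2) D := h3
    _ = 1 * (Skeleton.bigP D * eps1 (c₁ / 2 / 2 / 2) D) := (one_mul _).symm


/-! ## `Z22:§7.u049` from (7.19), `Z22:§7.u045`, `Z22:§7.u047` and the contour bound -/

/-- `(x/y)^{−s} = (y/x)^{s}` for positive reals `x, y`. [folklore] -/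
private theorem ofReal_div_cpow_neg {x y : ℝ} (hx : 0 < x) (hy : 0 < y) (s : ℂ) :
    ((x / y : ℝ) : ℂ) ^ (-s) = ((y / x : ℝ) : ℂ) ^ s := by
  have h1 : ((x / y : ℝ) : ℂ) ≠ 0 := by exact_mod_cast (div_pos hx hy).ne'
  have h2 : ((y / x : ℝ) : ℂ) ≠ 0 := by exact_mod_cast (div_pos hy hx).ne'
  rw [Complex.cpow_def_of_ne_zero h1, Complex.cpow_def_of_ne_zero h2]
  congr 1
  rw [← Complex.ofReal_log (div_pos hx hy).le, ← Complex.ofReal_log (div_pos hy hx).le,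
    Real.log_div hx.ne' hy.ne', Real.log_div hy.ne' hx.ne']
  push_cast
  ring

/-- **EDGE `(7.19) ∧ Z22:§7.u045 ∧ Z22:§7.u047 ∧ (contour bound) ⇒ Z22:§7.u049` (kernel-checked).**
"This yields, by Lemma 5.2 (i) [read: 5.4 (i)] and standard estimates, that the integral (7.18)
[read: (7.19)] is equal to the sum of the residues … plus an acceptable error. Namely
`Σ_{(l,kd₂)=1} κ(d₁l)Δ(ll₂/(pk)) = Σ_{1≤j≤3} 𝔯ⱼκ̃₀ⱼ(d₁;d₂k)λ₀ⱼ(d₁d₂k)(pk/l₂)^{1−β_j} + O(pkε₁/l₂)`"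
(§7 p. 40). This theorem ISOLATES the analytic content of the step: given the Mellin formula (7.19)
(`Eq719`), the Euler-product identity `Σ_{(l,m)=1}κ(d₁l)l^{−s} = κ̃λ·ζζζ/ζ` on `σ > 1`
(`Step7u045`, so the two Mellin integrands agree on the line `σ = 3/2`), and the contour move with
its three residues (`Step7u047`), the node `Step7u049` FOLLOWS from — and, modulo these, IS — the
displayed "standard estimates" bound on the shifted contour,
`‖(1/2πi)∫_𝒞 (l₂/pk)^{−s} κ̃λ ζζζ/ζ δ ds‖ ≤ C·pkε₁/l₂`, taken here as an explicit hypothesis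
(it is where `δ(s) ≪ 𝓛ᶜ|s|⁻²`, the size of `1/ζ` on `σ = 1 − 𝓛⁻¹`, and `(pk/l₂)^{−𝓛⁻¹} ≤ T^{−2/𝓛}
= ε₁` with `c = 2` enter; not typed as a separate node in `Section7dStatements`). The bookkeeping
`(l₂/pk)^{−(1−β_j)} = (pk/l₂)^{1−β_j}` is `ofReal_div_cpow_neg`.
[cite: Zhang2022LandauSiegel, §7 p.40, tex L2118–L2126] -/
theorem step7u049_of (c' : ℝ) (h719 : Eq719 c') (h45 : Step7u045 c') (h47 : Step7u047 c')
    (hbound : ∃ c : ℝ, 0 < c ∧ ∃ C : ℝ, Skeleton.ForAllLarge fun D _ χ =>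
      Skeleton.AssumptionA D χ → ∀ p ∈ Skeleton.primeWindow D, ∀ d₁ d₂ k l₂ : ℕ,
        0 < d₁ → 0 < d₂ → 0 < k → 0 < l₂ →
        ((d₂ * l₂ : ℕ) : ℝ) < Skeleton.bigP D / Skeleton.bigT D ^ 2 →
        ((d₁ * d₂ * k : ℕ) : ℝ) < Skeleton.bigP D / Skeleton.bigT D ^ 2 →
          ‖contour719 D (fun s =>
              (((l₂ : ℝ) / ((p : ℝ) * k) : ℝ) : ℂ) ^ (-s) *
                (Skeleton.kappaTilde c' D d₁ (d₂ * k) s * Skeleton.lam c' D (d₁ * d₂ * k) s *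
                  resFn c' D s))‖ ≤ C * ((p : ℝ) * k * eps1 c D / l₂)) :
    Step7u049 c' := by
  obtain ⟨c, hc, C, D₀, hbound⟩ := hbound
  obtain ⟨D₁, h719⟩ := h719
  obtain ⟨D₂, h47⟩ := h47
  refine ⟨c, hc, C, max D₀ (max D₁ D₂), ?_⟩
  intro D _ χ hD hq hprim hA p hp d₁ d₂ k l₂ hd₁ hd₂ hk hl₂ hdl hdk
  have hD₀ : D₀ ≤ D := le_trans (le_max_left _ _) hD
  have hD₁ : D₁ ≤ D := le_trans ((le_max_left _ _).trans (le_max_right _ _)) hD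
  have hD₂ : D₂ ≤ D := le_trans ((le_max_right _ _).trans (le_max_right _ _)) hD
  have e719 := h719 D χ hD₁ hq hprim hA p hp d₁ d₂ k l₂ hd₁ hd₂ hk hl₂
  have e47 := h47 D χ hD₂ hq hprim hA p hp d₁ d₂ k l₂ hd₁ hd₂ hk hl₂ hdl hdk
  have bnd := hbound D χ hD₀ hq hprim hA p hp d₁ d₂ k l₂ hd₁ hd₂ hk hl₂ hdl hdk
  have hp0 : 0 < p := (Finset.mem_filter.mp hp).2.pos
  have hpk : 0 < (p : ℝ) * k := by
    have : (0 : ℝ) < p := by exact_mod_cast hp0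
    have : (0 : ℝ) < k := by exact_mod_cast hk
    positivity
  have hl₂R : (0 : ℝ) < l₂ := by exact_mod_cast hl₂
  -- the two Mellin integrands agree on the line `σ = 3/2`
  have hcongr : mellinInv (3 / 2) (fun s => kapSer c' D d₁ (d₂ * k) s * Skeleton.deltaW D s)
        ((l₂ : ℝ) / ((p : ℝ) * k)) =
      mellinInv (3 / 2) (fun s => Skeleton.kappaTilde c' D d₁ (d₂ * k) s *
        Skeleton.lam c' D (d₁ * d₂ * k) s * resFn c' D s) ((l₂ : ℝ) / ((p : ℝ) * k)) := by
    simp only [mellinInv]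
    congr 1
    refine MeasureTheory.integral_congr_ae (MeasureTheory.ae_of_all _ fun y => ?_)
    have hs : 1 < (((3 / 2 : ℝ) : ℂ) + (y : ℂ) * I).re := by
      simp only [Complex.add_re, Complex.ofReal_re, Complex.mul_re, Complex.I_re, Complex.I_im,
        Complex.ofReal_im, mul_zero, zero_mul, sub_zero, add_zero]
      norm_num
    simp only
    rw [h45 D d₁ (d₂ * k) hd₁ (Nat.mul_pos hd₂ hk) _ hs, resFn, Nat.mul_assoc]
    ring
  -- the residue terms agree: `(l₂/pk)^{−(1−β_j)} = (pk/l₂)^{1−β_j}`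
  have hres : (∑ j ∈ Finset.Icc 1 3,
      frakr c' D j * Skeleton.kappaTildeZero c' D j d₁ (d₂ * k) *
          Skeleton.lamZero c' D j (d₁ * d₂ * k) *
        (((l₂ : ℝ) / ((p : ℝ) * k) : ℝ) : ℂ) ^ (-(1 - Skeleton.betaJ c' D j))) =
      ∑ j ∈ Finset.Icc 1 3,
        frakr c' D j * Skeleton.kappaTildeZero c' D j d₁ (d₂ * k) *
            Skeleton.lamZero c' D j (d₁ * d₂ * k) *
          ((((p : ℝ) * k) / l₂ : ℝ) : ℂ) ^ (1 - Skeleton.betaJ c' D j) :=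
    Finset.sum_congr rfl fun j _ => by rw [ofReal_div_cpow_neg hl₂R hpk]
  rw [e719, hcongr, e47, hres, add_sub_cancel_right]
  exact bnd


/-! ## The chain with a `d₁`-dependent weight (G-d24-1: the printed uniform constants of
`Z22:§7.u049`/`Z22:§7.u052` do not follow from the manuscript's own bounds; the chain below carries an
arbitrary weight `G D d₁ d₂ k ≥ 0` through (7.19) → u049 → u052 → (7.20), (7.20) surviving AS
PRINTED whenever `Σ_{d₁,d₂,k<PT⁻²} G/(d₁d₂φ(k)) ≪ 𝓛^K`) -/

/-- **Absorbing `𝓛^K` into `ε₁` by halving its constant**: for every `A`, `K` and `c₀ > 0`,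
`A·𝓛^K·ε₁(c₀) ≤ ε₁(c₀/2)` for all large `D` (`x^{10K}/(10K)! ≤ eˣ`, `𝓛^K = (𝓛^{1/10})^{10K}`).
[cite: Zhang2022LandauSiegel, §7 p.40, tex L2127] -/
theorem absorb_pow_log_eps1 (A : ℝ) (K : ℕ) (c₀ : ℝ) (hc₀ : 0 < c₀) :
    ∃ D₁ : ℕ, ∀ D : ℕ, D₁ ≤ D → A * Skeleton.ell D ^ K * eps1 c₀ D ≤ eps1 (c₀ / 2) D := by
  set n : ℕ := 10 * K with hn
  set M : ℝ := (Nat.factorial n : ℝ) * (4 / c₀) ^ n with hM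
  set K' : ℝ := |A| * M + 1 with hK'
  have hM0 : 0 ≤ M := by positivity
  have hK'1 : 1 ≤ K' := by
    have h0 : 0 ≤ |A| * M := by positivity
    rw [hK']
    linarith
  set u₁ : ℝ := max (4 * Real.log K' / c₀) 0 with hu₁
  have hu₁0 : 0 ≤ u₁ := le_max_right _ _
  refine ⟨⌈Real.exp (u₁ ^ 10)⌉₊, fun D hD => ?_⟩
  have hexpD : Real.exp (u₁ ^ 10) ≤ D := (Nat.le_ceil _).trans (by exact_mod_cast hD)
  have hDpos : (0 : ℝ) < D := lt_of_lt_of_le (Real.exp_pos _) hexpD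
  have hℓ : u₁ ^ 10 ≤ Skeleton.ell D := (Real.le_log_iff_exp_le hDpos).mpr hexpD
  have hℓ0 : 0 ≤ Skeleton.ell D := le_trans (by positivity) hℓ
  set u : ℝ := Skeleton.ell D ^ ((1 : ℝ) / 10) with hu
  have hu0 : 0 ≤ u := Real.rpow_nonneg hℓ0 _
  have hu₁u : u₁ ≤ u := by
    have h := Real.rpow_le_rpow (by positivity) hℓ (by norm_num : (0 : ℝ) ≤ (1 : ℝ) / 10)
    have h2 : (u₁ ^ 10) ^ ((1 : ℝ) / 10) = u₁ := by
      rw [show ((1 : ℝ) / 10) = ((10 : ℕ) : ℝ)⁻¹ by norm_num]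
      exact Real.pow_rpow_inv_natCast hu₁0 (by norm_num)
    rwa [h2] at h
  have hℓK : Skeleton.ell D ^ K = u ^ n := by
    rw [hu, ← Real.rpow_mul_natCast hℓ0, hn,
      show ((1 : ℝ) / 10 * ((10 * K : ℕ) : ℝ) : ℝ) = ((K : ℕ) : ℝ) by push_cast; ring,
      Real.rpow_natCast]
  have hpow : u ^ n ≤ M * Real.exp (c₀ / 4 * u) := by
    have h := Real.pow_div_factorial_le_exp (c₀ / 4 * u) (by positivity) n
    have hun : u ^ n = (4 / c₀) ^ n * (c₀ / 4 * u) ^ n := by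
      rw [← mul_pow]; congr 1; field_simp
    have hfac : (0 : ℝ) < Nat.factorial n := by positivity
    rw [hun, hM]
    calc (4 / c₀) ^ n * (c₀ / 4 * u) ^ n
        = ((Nat.factorial n : ℝ) * (4 / c₀) ^ n) * ((c₀ / 4 * u) ^ n / Nat.factorial n) := by
          field_simp
      _ ≤ ((Nat.factorial n : ℝ) * (4 / c₀) ^ n) * Real.exp (c₀ / 4 * u) := by gcongr
  have hKle : A * u ^ n ≤ K' * Real.exp (c₀ / 4 * u) := by
    have hex1 : 1 ≤ Real.exp (c₀ / 4 * u) := Real.one_le_exp (by positivity)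
    have h1 : A * u ^ n ≤ |A| * u ^ n := mul_le_mul_of_nonneg_right (le_abs_self A) (by positivity)
    have h2 : |A| * u ^ n ≤ |A| * (M * Real.exp (c₀ / 4 * u)) := by gcongr
    have h3 : |A| * (M * Real.exp (c₀ / 4 * u)) ≤ K' * Real.exp (c₀ / 4 * u) := by
      rw [hK']
      nlinarith [abs_nonneg A, hM0, hex1]
    linarith
  have hK'le : K' ≤ Real.exp (c₀ / 4 * u) := by
    have h1 : 4 * Real.log K' / c₀ ≤ u := (le_max_left _ _).trans hu₁u
    have h2 : Real.log K' ≤ c₀ / 4 * u := by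
      have h := mul_le_mul_of_nonneg_left h1 (le_of_lt (by positivity : (0 : ℝ) < c₀ / 4))
      calc Real.log K' = c₀ / 4 * (4 * Real.log K' / c₀) := by field_simp
        _ ≤ c₀ / 4 * u := h
    calc K' = Real.exp (Real.log K') := (Real.exp_log (by linarith)).symm
      _ ≤ Real.exp (c₀ / 4 * u) := Real.exp_le_exp.mpr h2
  have hfin : A * u ^ n * Real.exp (-(c₀ / 2 * u)) ≤ 1 := by
    have hE : K' * Real.exp (c₀ / 4 * u) ≤ Real.exp (c₀ / 4 * u) * Real.exp (c₀ / 4 * u) :=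
      mul_le_mul_of_nonneg_right hK'le (Real.exp_pos _).le
    have h : A * u ^ n ≤ Real.exp (c₀ / 2 * u) := by
      calc A * u ^ n ≤ K' * Real.exp (c₀ / 4 * u) := hKle
        _ ≤ Real.exp (c₀ / 4 * u) * Real.exp (c₀ / 4 * u) := hE
        _ = Real.exp (c₀ / 2 * u) := by rw [← Real.exp_add]; congr 1; ring
    calc A * u ^ n * Real.exp (-(c₀ / 2 * u))
        ≤ Real.exp (c₀ / 2 * u) * Real.exp (-(c₀ / 2 * u)) :=
          mul_le_mul_of_nonneg_right h (Real.exp_pos _).le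
      _ = 1 := by rw [← Real.exp_add, add_neg_cancel, Real.exp_zero]
  have hε : eps1 c₀ D = eps1 (c₀ / 2) D * Real.exp (-(c₀ / 2 * u)) := by
    rw [eps1, eps1, ← Real.exp_add]; congr 1; rw [hu]; ring
  have hε2 : 0 < eps1 (c₀ / 2) D := Real.exp_pos _
  rw [hε, hℓK]
  calc A * u ^ n * (eps1 (c₀ / 2) D * Real.exp (-(c₀ / 2 * u)))
      = eps1 (c₀ / 2) D * (A * u ^ n * Real.exp (-(c₀ / 2 * u))) := by ring
    _ ≤ eps1 (c₀ / 2) D * 1 := mul_le_mul_of_nonneg_left hfin hε2.le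
    _ = eps1 (c₀ / 2) D := mul_one _

/-- **Weighted EDGE `(7.19) ∧ §7.u045 ∧ §7.u047 ∧ (contour bound with weight G) ⇒ §7.u049 with
weight G`**: as `step7u049_of`, with the contour bound — and hence the residue formula's error — of
the form `C·G(D,d₁,d₂,k)·pkε₁/l₂` for an arbitrary weight `G` (G-d24-1: the derivable weight is
`d₁`-dependent, e.g. `τ₅(d₁)∏_{q∣d₁d₂k}(1 + cq^{−9/10})²`; the printed/typed `Step7u049` is the case
`G ≡ 1`). [cite: Zhang2022LandauSiegel, §7 p.40, tex L2118–L2126] -/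
theorem step7u049_of_weighted (c' : ℝ) (G : ℕ → ℕ → ℕ → ℕ → ℝ) (h719 : Eq719 c')
    (h45 : Step7u045 c') (h47 : Step7u047 c')
    (hbound : ∃ c : ℝ, 0 < c ∧ ∃ C : ℝ, Skeleton.ForAllLarge fun D _ χ =>
      Skeleton.AssumptionA D χ → ∀ p ∈ Skeleton.primeWindow D, ∀ d₁ d₂ k l₂ : ℕ,
        0 < d₁ → 0 < d₂ → 0 < k → 0 < l₂ →
        ((d₂ * l₂ : ℕ) : ℝ) < Skeleton.bigP D / Skeleton.bigT D ^ 2 →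
        ((d₁ * d₂ * k : ℕ) : ℝ) < Skeleton.bigP D / Skeleton.bigT D ^ 2 →
          ‖contour719 D (fun s =>
              (((l₂ : ℝ) / ((p : ℝ) * k) : ℝ) : ℂ) ^ (-s) *
                (Skeleton.kappaTilde c' D d₁ (d₂ * k) s * Skeleton.lam c' D (d₁ * d₂ * k) s *
                  resFn c' D s))‖ ≤ C * G D d₁ d₂ k * ((p : ℝ) * k * eps1 c D / l₂)) :
    ∃ c : ℝ, 0 < c ∧ ∃ C : ℝ, Skeleton.ForAllLarge fun D _ χ => Skeleton.AssumptionA D χ →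
      ∀ p ∈ Skeleton.primeWindow D, ∀ d₁ d₂ k l₂ : ℕ, 0 < d₁ → 0 < d₂ → 0 < k → 0 < l₂ →
        ((d₂ * l₂ : ℕ) : ℝ) < Skeleton.bigP D / Skeleton.bigT D ^ 2 →
        ((d₁ * d₂ * k : ℕ) : ℝ) < Skeleton.bigP D / Skeleton.bigT D ^ 2 →
          ‖innerDeltaSum c' D d₁ (d₂ * k) ((l₂ : ℝ) / ((p : ℝ) * k)) -
              ∑ j ∈ Finset.Icc 1 3,
                frakr c' D j * Skeleton.kappaTildeZero c' D j d₁ (d₂ * k) *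
                    Skeleton.lamZero c' D j (d₁ * d₂ * k) *
                  ((((p : ℝ) * k) / l₂ : ℝ) : ℂ) ^ (1 - Skeleton.betaJ c' D j)‖
            ≤ C * G D d₁ d₂ k * ((p : ℝ) * k * eps1 c D / l₂) := by
  obtain ⟨c, hc, C, D₀, hbound⟩ := hbound
  obtain ⟨D₁, h719⟩ := h719
  obtain ⟨D₂, h47⟩ := h47
  refine ⟨c, hc, C, max D₀ (max D₁ D₂), ?_⟩
  intro D _ χ hD hq hprim hA p hp d₁ d₂ k l₂ hd₁ hd₂ hk hl₂ hdl hdk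
  have hD₀ : D₀ ≤ D := le_trans (le_max_left _ _) hD
  have hD₁ : D₁ ≤ D := le_trans ((le_max_left _ _).trans (le_max_right _ _)) hD
  have hD₂ : D₂ ≤ D := le_trans ((le_max_right _ _).trans (le_max_right _ _)) hD
  have e719 := h719 D χ hD₁ hq hprim hA p hp d₁ d₂ k l₂ hd₁ hd₂ hk hl₂
  have e47 := h47 D χ hD₂ hq hprim hA p hp d₁ d₂ k l₂ hd₁ hd₂ hk hl₂ hdl hdk
  have bnd := hbound D χ hD₀ hq hprim hA p hp d₁ d₂ k l₂ hd₁ hd₂ hk hl₂ hdl hdk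
  have hp0 : 0 < p := (Finset.mem_filter.mp hp).2.pos
  have hpk : 0 < (p : ℝ) * k := by
    have : (0 : ℝ) < p := by exact_mod_cast hp0
    have : (0 : ℝ) < k := by exact_mod_cast hk
    positivity
  have hl₂R : (0 : ℝ) < l₂ := by exact_mod_cast hl₂
  have hcongr : mellinInv (3 / 2) (fun s => kapSer c' D d₁ (d₂ * k) s * Skeleton.deltaW D s)
        ((l₂ : ℝ) / ((p : ℝ) * k)) =
      mellinInv (3 / 2) (fun s => Skeleton.kappaTilde c' D d₁ (d₂ * k) s *
        Skeleton.lam c' D (d₁ * d₂ * k) s * resFn c' D s) ((l₂ : ℝ) / ((p : ℝ) * k)) := by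
    simp only [mellinInv]
    congr 1
    refine MeasureTheory.integral_congr_ae (MeasureTheory.ae_of_all _ fun y => ?_)
    have hs : 1 < (((3 / 2 : ℝ) : ℂ) + (y : ℂ) * I).re := by
      simp only [Complex.add_re, Complex.ofReal_re, Complex.mul_re, Complex.I_re, Complex.I_im,
        Complex.ofReal_im, mul_zero, zero_mul, sub_zero, add_zero]
      norm_num
    simp only
    rw [h45 D d₁ (d₂ * k) hd₁ (Nat.mul_pos hd₂ hk) _ hs, resFn, Nat.mul_assoc]
    ring
  have hres : (∑ j ∈ Finset.Icc 1 3,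
      frakr c' D j * Skeleton.kappaTildeZero c' D j d₁ (d₂ * k) *
          Skeleton.lamZero c' D j (d₁ * d₂ * k) *
        (((l₂ : ℝ) / ((p : ℝ) * k) : ℝ) : ℂ) ^ (-(1 - Skeleton.betaJ c' D j))) =
      ∑ j ∈ Finset.Icc 1 3,
        frakr c' D j * Skeleton.kappaTildeZero c' D j d₁ (d₂ * k) *
            Skeleton.lamZero c' D j (d₁ * d₂ * k) *
          ((((p : ℝ) * k) / l₂ : ℝ) : ℂ) ^ (1 - Skeleton.betaJ c' D j) :=
    Finset.sum_congr rfl fun j _ => by rw [ofReal_div_cpow_neg hl₂R hpk]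
  rw [e719, hcongr, e47, hres, add_sub_cancel_right]
  exact bnd

/-- **Weighted EDGE `§7.u049[G] ⇒ §7.u052[G]`**: as `ded7u052_of` with the error carrying a weight
`G(D,d₁,d₂,k) ≥ 0` (independent of `l₂`): multiply by `a₁(d₂l₂)`, sum the finitely many `l₂`, and
absorb `3B·(2 + 𝓛⁹)` into `ε₁` by halving its constant. [cite: Zhang2022LandauSiegel, §7 p.41, tex L2131] -/
theorem ded7u052_of_weighted (c' : ℝ) (G : ℕ → ℕ → ℕ → ℕ → ℝ) (hG : ∀ D d₁ d₂ k, 0 ≤ G D d₁ d₂ k)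
    (h49 : ∃ c : ℝ, 0 < c ∧ ∃ C : ℝ, Skeleton.ForAllLarge fun D _ χ => Skeleton.AssumptionA D χ →
      ∀ p ∈ Skeleton.primeWindow D, ∀ d₁ d₂ k l₂ : ℕ, 0 < d₁ → 0 < d₂ → 0 < k → 0 < l₂ →
        ((d₂ * l₂ : ℕ) : ℝ) < Skeleton.bigP D / Skeleton.bigT D ^ 2 →
        ((d₁ * d₂ * k : ℕ) : ℝ) < Skeleton.bigP D / Skeleton.bigT D ^ 2 →
          ‖innerDeltaSum c' D d₁ (d₂ * k) ((l₂ : ℝ) / ((p : ℝ) * k)) -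
              ∑ j ∈ Finset.Icc 1 3,
                frakr c' D j * Skeleton.kappaTildeZero c' D j d₁ (d₂ * k) *
                    Skeleton.lamZero c' D j (d₁ * d₂ * k) *
                  ((((p : ℝ) * k) / l₂ : ℝ) : ℂ) ^ (1 - Skeleton.betaJ c' D j)‖
            ≤ C * G D d₁ d₂ k * ((p : ℝ) * k * eps1 c D / l₂)) :
    ∀ B : ℝ, ∃ c : ℝ, 0 < c ∧ ∃ C : ℝ, Skeleton.ForAllLarge fun D _ χ => Skeleton.AssumptionA D χ →
      ∀ a₁ : ℕ → ℂ, Skeleton.Adm72 D B a₁ → ∀ p ∈ Skeleton.primeWindow D,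
        ∀ d₁ d₂ k : ℕ, 0 < d₁ → 0 < d₂ → 0 < k →
          ((d₁ * d₂ * k : ℕ) : ℝ) < Skeleton.bigP D / Skeleton.bigT D ^ 2 →
            ‖(∑' l₂ : ℕ, if 0 < l₂ ∧ Nat.Coprime l₂ k then
                  a₁ (d₂ * l₂) * innerDeltaSum c' D d₁ (d₂ * k) ((l₂ : ℝ) / ((p : ℝ) * k)) else 0) -
                ∑ j ∈ Finset.Icc 1 3,
                  frakr c' D j * ((((p : ℝ) * k : ℝ) : ℂ) ^ (1 - Skeleton.betaJ c' D j)) *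
                      Skeleton.kappaTildeZero c' D j d₁ (d₂ * k) *
                      Skeleton.lamZero c' D j (d₁ * d₂ * k) *
                    ∑' l : ℕ, if 0 < l ∧ Nat.Coprime l k then
                      a₁ (d₂ * l) / (l : ℂ) ^ (1 - Skeleton.betaJ c' D j) else 0‖
              ≤ C * G D d₁ d₂ k * (Skeleton.bigP D * k * eps1 c D) := by
  intro B
  obtain ⟨c₀, hc₀, C₀, D₀, h49⟩ := h49
  obtain ⟨D₁, hD₁⟩ := absorb_log_eps1 (3 * |B| * |C₀|) c₀ hc₀
  refine ⟨c₀ / 2, by positivity, 1, max D₀ (max D₁ 3), ?_⟩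
  intro D _ χ hD hq hprim hA a₁ ha₁ p hp d₁ d₂ k hd₁ hd₂ hk hdk
  have hD₀ : D₀ ≤ D := le_trans (le_max_left _ _) hD
  have hD₁' : D₁ ≤ D := le_trans ((le_max_left _ _).trans (le_max_right _ _)) hD
  have hD3 : 3 ≤ D := le_trans ((le_max_right _ _).trans (le_max_right _ _)) hD
  have h49D := h49 D χ hD₀ hq hprim hA p hp
  set N := Skeleton.Nsupp D with hN
  set S := (Finset.Ico 1 N).filter (fun l => Nat.Coprime l k) with hS
  have hB0 : 0 ≤ B := le_trans (norm_nonneg _) (ha₁.1 0)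
  have hp0 : 0 < p := (Finset.mem_filter.mp hp).2.pos
  have hpk : 0 < (p : ℝ) * k := by
    have : (0 : ℝ) < p := by exact_mod_cast hp0
    have : (0 : ℝ) < k := by exact_mod_cast hk
    positivity
  have hε0 : 0 < eps1 c₀ D := Real.exp_pos _
  have hP0 : 0 < Skeleton.bigP D := Real.exp_pos _
  have hk0 : (0 : ℝ) < k := by exact_mod_cast hk
  have hG0 : 0 ≤ G D d₁ d₂ k := hG D d₁ d₂ k
  have hsupp : ∀ l : ℕ, N ≤ l → a₁ (d₂ * l) = 0 := fun l hl =>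
    eq_zero_of_nsupp_le ha₁ (le_trans hl (Nat.le_mul_of_pos_left l hd₂))
  have hoff : ∀ (f : ℕ → ℂ) (l : ℕ), l ∉ S →
      (if 0 < l ∧ Nat.Coprime l k then a₁ (d₂ * l) * f l else 0) = 0 := by
    intro f l hl
    by_cases h : 0 < l ∧ Nat.Coprime l k
    · rw [if_pos h]
      have hNl : N ≤ l := le_of_not_gt fun hlt =>
        hl (by rw [hS, Finset.mem_filter, Finset.mem_Ico]; exact ⟨⟨h.1, hlt⟩, h.2⟩)
      rw [hsupp l hNl, zero_mul]
    · rw [if_neg h]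
  have hon : ∀ (f : ℕ → ℂ), ∀ l ∈ S,
      (if 0 < l ∧ Nat.Coprime l k then a₁ (d₂ * l) * f l else 0) = a₁ (d₂ * l) * f l := by
    intro f l hl
    rw [hS, Finset.mem_filter, Finset.mem_Ico] at hl
    rw [if_pos ⟨hl.1.1, hl.2⟩]
  have hT1 : (∑' l₂ : ℕ, if 0 < l₂ ∧ Nat.Coprime l₂ k then
        a₁ (d₂ * l₂) * innerDeltaSum c' D d₁ (d₂ * k) ((l₂ : ℝ) / ((p : ℝ) * k)) else 0) =
      ∑ l₂ ∈ S, a₁ (d₂ * l₂) * innerDeltaSum c' D d₁ (d₂ * k) ((l₂ : ℝ) / ((p : ℝ) * k)) := by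
    rw [tsum_eq_sum (s := S)
      (hoff (fun l₂ => innerDeltaSum c' D d₁ (d₂ * k) ((l₂ : ℝ) / ((p : ℝ) * k))))]
    exact Finset.sum_congr rfl
      (hon (fun l₂ => innerDeltaSum c' D d₁ (d₂ * k) ((l₂ : ℝ) / ((p : ℝ) * k))))
  have hT2 : ∀ j : ℕ, (∑' l : ℕ, if 0 < l ∧ Nat.Coprime l k then
        a₁ (d₂ * l) / (l : ℂ) ^ (1 - Skeleton.betaJ c' D j) else 0) =
      ∑ l ∈ S, a₁ (d₂ * l) / (l : ℂ) ^ (1 - Skeleton.betaJ c' D j) := by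
    intro j
    have hoff' := hoff (fun l => ((l : ℂ) ^ (1 - Skeleton.betaJ c' D j))⁻¹)
    have hon' := hon (fun l => ((l : ℂ) ^ (1 - Skeleton.betaJ c' D j))⁻¹)
    simp only [← div_eq_mul_inv] at hoff' hon'
    rw [tsum_eq_sum (s := S) hoff']
    exact Finset.sum_congr rfl hon'
  have hM : (∑ j ∈ Finset.Icc 1 3,
      frakr c' D j * ((((p : ℝ) * k : ℝ) : ℂ) ^ (1 - Skeleton.betaJ c' D j)) *
          Skeleton.kappaTildeZero c' D j d₁ (d₂ * k) * Skeleton.lamZero c' D j (d₁ * d₂ * k) *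
        ∑ l ∈ S, a₁ (d₂ * l) / (l : ℂ) ^ (1 - Skeleton.betaJ c' D j)) =
      ∑ l₂ ∈ S, a₁ (d₂ * l₂) * ∑ j ∈ Finset.Icc 1 3,
        frakr c' D j * Skeleton.kappaTildeZero c' D j d₁ (d₂ * k) *
            Skeleton.lamZero c' D j (d₁ * d₂ * k) *
          ((((p : ℝ) * k) / l₂ : ℝ) : ℂ) ^ (1 - Skeleton.betaJ c' D j) := by
    simp only [Finset.mul_sum]
    rw [Finset.sum_comm]
    refine Finset.sum_congr rfl fun l₂ hl₂ => Finset.sum_congr rfl fun j _ => ?_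
    have hl₂pos : 0 < (l₂ : ℝ) := by
      rw [hS, Finset.mem_filter, Finset.mem_Ico] at hl₂
      exact_mod_cast hl₂.1.1
    rw [ofReal_div_cpow hpk hl₂pos, Complex.ofReal_natCast]
    ring
  have key : ‖(∑ l₂ ∈ S, a₁ (d₂ * l₂) * innerDeltaSum c' D d₁ (d₂ * k) ((l₂ : ℝ) / ((p : ℝ) * k))) -
      ∑ l₂ ∈ S, a₁ (d₂ * l₂) * ∑ j ∈ Finset.Icc 1 3,
        frakr c' D j * Skeleton.kappaTildeZero c' D j d₁ (d₂ * k) *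
            Skeleton.lamZero c' D j (d₁ * d₂ * k) *
          ((((p : ℝ) * k) / l₂ : ℝ) : ℂ) ^ (1 - Skeleton.betaJ c' D j)‖ ≤
      B * |C₀| * G D d₁ d₂ k * ((p : ℝ) * k * eps1 c₀ D) * ∑ l₂ ∈ S, 1 / (l₂ : ℝ) := by
    rw [← Finset.sum_sub_distrib, Finset.mul_sum]
    refine (norm_sum_le _ _).trans (Finset.sum_le_sum fun l₂ hl₂ => ?_)
    rw [hS, Finset.mem_filter, Finset.mem_Ico] at hl₂
    rw [← mul_sub, norm_mul]
    have hl₂pos : (0 : ℝ) < l₂ := by exact_mod_cast hl₂.1.1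
    by_cases hlt : ((d₂ * l₂ : ℕ) : ℝ) < Skeleton.bigP D / Skeleton.bigT D ^ 2
    · have h := h49D d₁ d₂ k l₂ hd₁ hd₂ hk hl₂.1.1 hlt hdk
      have hC : C₀ * G D d₁ d₂ k * ((p : ℝ) * k * eps1 c₀ D / l₂) ≤
          |C₀| * G D d₁ d₂ k * ((p : ℝ) * k * eps1 c₀ D / l₂) := by
        have : 0 ≤ G D d₁ d₂ k * ((p : ℝ) * k * eps1 c₀ D / l₂) := by positivity
        nlinarith [le_abs_self C₀]
      calc ‖a₁ (d₂ * l₂)‖ * ‖innerDeltaSum c' D d₁ (d₂ * k) ((l₂ : ℝ) / ((p : ℝ) * k)) -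
              ∑ j ∈ Finset.Icc 1 3,
                frakr c' D j * Skeleton.kappaTildeZero c' D j d₁ (d₂ * k) *
                    Skeleton.lamZero c' D j (d₁ * d₂ * k) *
                  ((((p : ℝ) * k) / l₂ : ℝ) : ℂ) ^ (1 - Skeleton.betaJ c' D j)‖
          ≤ B * (|C₀| * G D d₁ d₂ k * ((p : ℝ) * k * eps1 c₀ D / l₂)) :=
            mul_le_mul (ha₁.1 _) (h.trans hC) (norm_nonneg _) hB0
        _ = B * |C₀| * G D d₁ d₂ k * ((p : ℝ) * k * eps1 c₀ D) * (1 / (l₂ : ℝ)) := by ring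
    · have hz : a₁ (d₂ * l₂) = 0 := ha₁.2 _ (not_lt.mp hlt)
      rw [hz, norm_zero, zero_mul]
      positivity
  rw [hT1]
  simp_rw [hT2]
  rw [hM]
  refine key.trans ?_
  have hharm : ∑ l₂ ∈ S, 1 / (l₂ : ℝ) ≤ 2 + Skeleton.ell D ^ 9 := by
    calc ∑ l₂ ∈ S, 1 / (l₂ : ℝ) ≤ ∑ l₂ ∈ Finset.Ico 1 N, 1 / (l₂ : ℝ) :=
          Finset.sum_le_sum_of_subset_of_nonneg (Finset.filter_subset _ _)
            (fun _ _ _ => by positivity)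
      _ ≤ 1 + Real.log N := sum_Ico_inv_le_log N
      _ ≤ 2 + Skeleton.ell D ^ 9 := by linarith [log_nsupp_le D]
  have hp3 : (p : ℝ) ≤ 3 * Skeleton.bigP D := le_three_bigP_of_mem_primeWindow hD3 hp
  have habs := hD₁ D hD₁'
  rw [abs_of_nonneg hB0] at habs
  have hℓ9 : 0 ≤ 2 + Skeleton.ell D ^ 9 := by
    have : 0 ≤ Skeleton.ell D := Real.log_natCast_nonneg D
    positivity
  calc B * |C₀| * G D d₁ d₂ k * ((p : ℝ) * k * eps1 c₀ D) * ∑ l₂ ∈ S, 1 / (l₂ : ℝ)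
      ≤ B * |C₀| * G D d₁ d₂ k * ((3 * Skeleton.bigP D) * k * eps1 c₀ D) *
          (2 + Skeleton.ell D ^ 9) := by gcongr
    _ = G D d₁ d₂ k * (Skeleton.bigP D * k) *
          (3 * B * |C₀| * (2 + Skeleton.ell D ^ 9) * eps1 c₀ D) := by ring
    _ ≤ G D d₁ d₂ k * (Skeleton.bigP D * k) * eps1 (c₀ / 2) D :=
        mul_le_mul_of_nonneg_left habs (by positivity)
    _ = 1 * G D d₁ d₂ k * (Skeleton.bigP D * k * eps1 (c₀ / 2) D) := by ring

/-- **Weighted EDGE `(7.18) ∧ §7.u052[G] ⇒ (7.20) AS PRINTED`**, for any weight `G ≥ 0` whose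
`(7.18)`-average is polylogarithmic, `Σ_{d₁,d₂,k<⌈PT⁻²⌉} G(D,d₁,d₂,k)/(d₁d₂φ(k)) ≤ C₀𝓛^K` for large `D`
(this is the "harmless" clause of G-d24-1: the `d₁`-dependence of the contour error is summable
against the weights `1/(d₁d₂kφ(k))` of (7.18)); the polylogarithm is absorbed by halving the
`ε₁`-constant (`absorb_pow_log_eps1`). [cite: Zhang2022LandauSiegel, §7 (7.20) p.41, tex L2138] -/
theorem eq720_of_weighted (c' : ℝ) (G : ℕ → ℕ → ℕ → ℕ → ℝ) (hG : ∀ D d₁ d₂ k, 0 ≤ G D d₁ d₂ k)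
    (hsum : ∃ K : ℕ, ∃ C₀ : ℝ, ∃ D₁ : ℕ, ∀ D : ℕ, D₁ ≤ D →
      ∑ d₁ ∈ Finset.Ico 1 (Skeleton.Nsupp D), ∑ d₂ ∈ Finset.Ico 1 (Skeleton.Nsupp D),
        ∑ k ∈ Finset.Ico 1 (Skeleton.Nsupp D),
          G D d₁ d₂ k / ((d₁ : ℝ) * d₂ * (Nat.totient k : ℝ)) ≤ C₀ * Skeleton.ell D ^ K)
    (h718 : Eq718 c')
    (h52 : ∀ B : ℝ, ∃ c : ℝ, 0 < c ∧ ∃ C : ℝ, Skeleton.ForAllLarge fun D _ χ =>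
      Skeleton.AssumptionA D χ → ∀ a₁ : ℕ → ℂ, Skeleton.Adm72 D B a₁ →
        ∀ p ∈ Skeleton.primeWindow D, ∀ d₁ d₂ k : ℕ, 0 < d₁ → 0 < d₂ → 0 < k →
          ((d₁ * d₂ * k : ℕ) : ℝ) < Skeleton.bigP D / Skeleton.bigT D ^ 2 →
            ‖(∑' l₂ : ℕ, if 0 < l₂ ∧ Nat.Coprime l₂ k then
                  a₁ (d₂ * l₂) * innerDeltaSum c' D d₁ (d₂ * k) ((l₂ : ℝ) / ((p : ℝ) * k)) else 0) -
                ∑ j ∈ Finset.Icc 1 3,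
                  frakr c' D j * ((((p : ℝ) * k : ℝ) : ℂ) ^ (1 - Skeleton.betaJ c' D j)) *
                      Skeleton.kappaTildeZero c' D j d₁ (d₂ * k) *
                      Skeleton.lamZero c' D j (d₁ * d₂ * k) *
                    ∑' l : ℕ, if 0 < l ∧ Nat.Coprime l k then
                      a₁ (d₂ * l) / (l : ℂ) ^ (1 - Skeleton.betaJ c' D j) else 0‖
              ≤ C * G D d₁ d₂ k * (Skeleton.bigP D * k * eps1 c D)) :
    Eq720 c' := by
  intro B
  obtain ⟨D₂, h718⟩ := h718 B
  obtain ⟨c₁, hc₁, C₁, D₀, h52⟩ := h52 B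
  obtain ⟨K, C₀, D₃, hsum⟩ := hsum
  obtain ⟨D₁, hD₁⟩ := absorb_pow_log_eps1 (|B| * |C₁| * |C₀|) K c₁ hc₁
  refine ⟨c₁ / 2, by positivity, 1, max (max D₀ D₂) (max D₁ D₃), ?_⟩
  intro D _ χ hD hq hprim hA a₁ a₂ ha₁ ha₂ p hp
  have hD₀ : D₀ ≤ D := le_trans ((le_max_left _ _).trans (le_max_left _ _)) hD
  have hD₂ : D₂ ≤ D := le_trans ((le_max_right _ _).trans (le_max_left _ _)) hD
  have hD₁D : D₁ ≤ D := le_trans ((le_max_left _ _).trans (le_max_right _ _)) hD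
  have hD₃D : D₃ ≤ D := le_trans ((le_max_right _ _).trans (le_max_right _ _)) hD
  have h52D := h52 D χ hD₀ hq hprim hA a₁ ha₁ p hp
  rw [h718 D χ hD₂ hq hprim hA a₁ a₂ ha₁ ha₂ p hp]
  have hB0 : 0 ≤ B := le_trans (norm_nonneg _) (ha₁.1 0)
  have hp0 : 0 < p := (Finset.mem_filter.mp hp).2.pos
  have hpR : (0 : ℝ) < p := by exact_mod_cast hp0
  have hpC : (p : ℂ) ≠ 0 := by exact_mod_cast hp0.ne'
  have hε0 : 0 < eps1 c₁ D := Real.exp_pos _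
  have hP0 : 0 < Skeleton.bigP D := Real.exp_pos _
  set T : ℕ → ℕ → ℕ → ℂ := fun d₁ d₂ k => ∑' l₂ : ℕ, if 0 < l₂ ∧ Nat.Coprime l₂ k then
      a₁ (d₂ * l₂) * innerDeltaSum c' D d₁ (d₂ * k) ((l₂ : ℝ) / ((p : ℝ) * k)) else 0 with hT
  set M : ℕ → ℕ → ℕ → ℂ := fun d₁ d₂ k => ∑ j ∈ Finset.Icc 1 3,
      frakr c' D j * ((((p : ℝ) * k : ℝ) : ℂ) ^ (1 - Skeleton.betaJ c' D j)) *
          Skeleton.kappaTildeZero c' D j d₁ (d₂ * k) * Skeleton.lamZero c' D j (d₁ * d₂ * k) *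
        ∑' l : ℕ, if 0 < l ∧ Nat.Coprime l k then
          a₁ (d₂ * l) / (l : ℂ) ^ (1 - Skeleton.betaJ c' D j) else 0 with hM
  set w : ℕ → ℕ → ℕ → ℂ := fun d₁ d₂ k =>
      a₂ (d₁ * d₂ * k) * (μ k : ℂ) / ((k : ℂ) * (Nat.totient k : ℂ)) with hw
  set F : ℕ → ℕ → ℕ → ℂ := fun j d k =>
      ∑ l ∈ (Finset.Ico 1 (Skeleton.Nsupp D)).filter (fun l => Nat.Coprime l k),
        a₁ (d * l) / (l : ℂ) ^ (1 - Skeleton.betaJ c' D j) with hF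
  change ‖(∑ d₁ ∈ Finset.Ico 1 (Skeleton.Nsupp D), ∑ d₂ ∈ Finset.Ico 1 (Skeleton.Nsupp D),
      ((d₁ : ℂ) * d₂)⁻¹ * ∑ k ∈ Finset.Ico 1 (Skeleton.Nsupp D), w d₁ d₂ k * T d₁ d₂ k) -
      ∑ j ∈ Finset.Icc 1 3, frakr c' D j * (p : ℂ) ^ (1 - Skeleton.betaJ c' D j) *
        SjStar c' D j a₁ a₂‖ ≤ 1 * (Skeleton.bigP D * eps1 (c₁ / 2) D)
  have hT2 : ∀ j d₂ k : ℕ, 0 < d₂ → (∑' l : ℕ, if 0 < l ∧ Nat.Coprime l k then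
      a₁ (d₂ * l) / (l : ℂ) ^ (1 - Skeleton.betaJ c' D j) else 0) = F j d₂ k := by
    intro j d₂ k hd₂
    simp only [hF]
    rw [tsum_eq_sum (s := Finset.Ico 1 (Skeleton.Nsupp D)) ?_, Finset.sum_filter]
    · refine Finset.sum_congr rfl fun l hl => ?_
      have hl1 : 0 < l := (Finset.mem_Ico.mp hl).1
      by_cases hc : Nat.Coprime l k
      · rw [if_pos ⟨hl1, hc⟩, if_pos hc]
      · rw [if_neg (fun h => hc h.2), if_neg hc]
    · intro l hl
      by_cases h : 0 < l ∧ Nat.Coprime l k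
      · have hNl : Skeleton.Nsupp D ≤ l :=
          le_of_not_gt fun hlt => hl (Finset.mem_Ico.mpr ⟨h.1, hlt⟩)
        rw [if_pos h, eq_zero_of_nsupp_le ha₁ (le_trans hNl (Nat.le_mul_of_pos_left l hd₂)),
          zero_div]
      · rw [if_neg h]
  have hSj : ∀ j : ℕ, SjStar c' D j a₁ a₂ =
      ∑ d ∈ Finset.Ico 1 (Skeleton.Nsupp D), ∑ d₁ ∈ Finset.Ico 1 (Skeleton.Nsupp D),
        ∑ k ∈ Finset.Ico 1 (Skeleton.Nsupp D),
          a₂ (d₁ * d * k) * Skeleton.kappaTildeZero c' D j d₁ (d * k) *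
                Skeleton.lamZero c' D j (d₁ * d * k) * (μ k : ℂ) /
              ((d₁ : ℂ) * d * (Nat.totient k : ℂ) * (k : ℂ) ^ Skeleton.betaJ c' D j) *
            F j d k := by
    intro j
    simp only [hF, SjStar]
  have hmain : (∑ d₁ ∈ Finset.Ico 1 (Skeleton.Nsupp D), ∑ d₂ ∈ Finset.Ico 1 (Skeleton.Nsupp D),
      ((d₁ : ℂ) * d₂)⁻¹ * ∑ k ∈ Finset.Ico 1 (Skeleton.Nsupp D), w d₁ d₂ k *
        ∑ j ∈ Finset.Icc 1 3,
          frakr c' D j * ((((p : ℝ) * k : ℝ) : ℂ) ^ (1 - Skeleton.betaJ c' D j)) *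
              Skeleton.kappaTildeZero c' D j d₁ (d₂ * k) *
            Skeleton.lamZero c' D j (d₁ * d₂ * k) * F j d₂ k) =
      ∑ j ∈ Finset.Icc 1 3, frakr c' D j * (p : ℂ) ^ (1 - Skeleton.betaJ c' D j) *
        SjStar c' D j a₁ a₂ := by
    simp only [hSj, Finset.mul_sum]
    rw [sum4_reorder]
    refine Finset.sum_congr rfl fun j _ => Finset.sum_congr rfl fun d₂ hd₂ =>
      Finset.sum_congr rfl fun d₁ hd₁ => Finset.sum_congr rfl fun k hk => ?_
    have hk0 : 0 < k := (Finset.mem_Ico.mp hk).1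
    have hd₁0 : 0 < d₁ := (Finset.mem_Ico.mp hd₁).1
    have hd₂0 : 0 < d₂ := (Finset.mem_Ico.mp hd₂).1
    have hkC : (k : ℂ) ≠ 0 := by exact_mod_cast hk0.ne'
    have hd₁C : (d₁ : ℂ) ≠ 0 := by exact_mod_cast hd₁0.ne'
    have hd₂C : (d₂ : ℂ) ≠ 0 := by exact_mod_cast hd₂0.ne'
    have hφC : (Nat.totient k : ℂ) ≠ 0 := by exact_mod_cast (Nat.totient_pos.mpr hk0).ne'
    have hkβ : (k : ℂ) ^ Skeleton.betaJ c' D j ≠ 0 := by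
      rw [cpow_def_of_ne_zero hkC]; exact Complex.exp_ne_zero _
    have hpow : ((((p : ℝ) * k : ℝ)) : ℂ) ^ (1 - Skeleton.betaJ c' D j) =
        (p : ℂ) ^ (1 - Skeleton.betaJ c' D j) * ((k : ℂ) / (k : ℂ) ^ Skeleton.betaJ c' D j) := by
      push_cast
      rw [Complex.natCast_mul_natCast_cpow, Complex.cpow_sub _ _ hkC, Complex.cpow_one]
    simp only [hw, hpow]
    field_simp
  have hMeq : (∑ d₁ ∈ Finset.Ico 1 (Skeleton.Nsupp D), ∑ d₂ ∈ Finset.Ico 1 (Skeleton.Nsupp D),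
      ((d₁ : ℂ) * d₂)⁻¹ * ∑ k ∈ Finset.Ico 1 (Skeleton.Nsupp D), w d₁ d₂ k * M d₁ d₂ k) =
      ∑ j ∈ Finset.Icc 1 3, frakr c' D j * (p : ℂ) ^ (1 - Skeleton.betaJ c' D j) *
        SjStar c' D j a₁ a₂ := by
    rw [← hmain]
    refine Finset.sum_congr rfl fun d₁ _ => Finset.sum_congr rfl fun d₂ hd₂ => ?_
    congr 1
    refine Finset.sum_congr rfl fun k _ => ?_
    congr 1
    simp only [hM]
    refine Finset.sum_congr rfl fun j _ => ?_
    rw [hT2 j d₂ k (Finset.mem_Ico.mp hd₂).1]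
  have hsplit : (∑ d₁ ∈ Finset.Ico 1 (Skeleton.Nsupp D), ∑ d₂ ∈ Finset.Ico 1 (Skeleton.Nsupp D),
      ((d₁ : ℂ) * d₂)⁻¹ * ∑ k ∈ Finset.Ico 1 (Skeleton.Nsupp D), w d₁ d₂ k * T d₁ d₂ k) -
      (∑ d₁ ∈ Finset.Ico 1 (Skeleton.Nsupp D), ∑ d₂ ∈ Finset.Ico 1 (Skeleton.Nsupp D),
      ((d₁ : ℂ) * d₂)⁻¹ * ∑ k ∈ Finset.Ico 1 (Skeleton.Nsupp D), w d₁ d₂ k * M d₁ d₂ k) =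
      ∑ d₁ ∈ Finset.Ico 1 (Skeleton.Nsupp D), ∑ d₂ ∈ Finset.Ico 1 (Skeleton.Nsupp D),
        ((d₁ : ℂ) * d₂)⁻¹ * ∑ k ∈ Finset.Ico 1 (Skeleton.Nsupp D),
          w d₁ d₂ k * (T d₁ d₂ k - M d₁ d₂ k) := by
    simp only [mul_sub, Finset.sum_sub_distrib]
  have hterm : ∀ d₁ ∈ Finset.Ico 1 (Skeleton.Nsupp D), ∀ d₂ ∈ Finset.Ico 1 (Skeleton.Nsupp D),
      ∀ k ∈ Finset.Ico 1 (Skeleton.Nsupp D),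
        ‖((d₁ : ℂ) * d₂)⁻¹ * (w d₁ d₂ k * (T d₁ d₂ k - M d₁ d₂ k))‖ ≤
          B * |C₁| * Skeleton.bigP D * eps1 c₁ D *
            (G D d₁ d₂ k / ((d₁ : ℝ) * d₂ * (Nat.totient k : ℝ))) := by
    intro d₁ hd₁ d₂ hd₂ k hk
    have hd₁0 : 0 < d₁ := (Finset.mem_Ico.mp hd₁).1
    have hd₂0 : 0 < d₂ := (Finset.mem_Ico.mp hd₂).1
    have hk0 : 0 < k := (Finset.mem_Ico.mp hk).1
    have hφ0 : 0 < Nat.totient k := Nat.totient_pos.mpr hk0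
    have hd₁R : (0 : ℝ) < d₁ := by exact_mod_cast hd₁0
    have hd₂R : (0 : ℝ) < d₂ := by exact_mod_cast hd₂0
    have hkR : (0 : ℝ) < k := by exact_mod_cast hk0
    have hφR : (0 : ℝ) < Nat.totient k := by exact_mod_cast hφ0
    have hG0 : 0 ≤ G D d₁ d₂ k := hG D d₁ d₂ k
    have hinv : ‖((d₁ : ℂ) * d₂)⁻¹‖ = 1 / ((d₁ : ℝ) * d₂) := by
      rw [norm_inv, norm_mul, Complex.norm_natCast, Complex.norm_natCast, one_div]
    rw [norm_mul, norm_mul, hinv]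
    by_cases hlt : ((d₁ * d₂ * k : ℕ) : ℝ) < Skeleton.bigP D / Skeleton.bigT D ^ 2
    · have h := h52D d₁ d₂ k hd₁0 hd₂0 hk0 hlt
      change ‖T d₁ d₂ k - M d₁ d₂ k‖ ≤ C₁ * G D d₁ d₂ k * (Skeleton.bigP D * k * eps1 c₁ D) at h
      have hC : C₁ * G D d₁ d₂ k * (Skeleton.bigP D * k * eps1 c₁ D) ≤
          |C₁| * G D d₁ d₂ k * (Skeleton.bigP D * k * eps1 c₁ D) := by
        have : 0 ≤ G D d₁ d₂ k * (Skeleton.bigP D * k * eps1 c₁ D) := by positivity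
        nlinarith [le_abs_self C₁]
      have hwB := norm_weight_le ha₂ (d₁ * d₂ * k) k hk0
      calc 1 / ((d₁ : ℝ) * d₂) * (‖w d₁ d₂ k‖ * ‖T d₁ d₂ k - M d₁ d₂ k‖)
          ≤ 1 / ((d₁ : ℝ) * d₂) * (B / ((k : ℝ) * Nat.totient k) *
              (|C₁| * G D d₁ d₂ k * (Skeleton.bigP D * k * eps1 c₁ D))) := by
            refine mul_le_mul_of_nonneg_left ?_ (by positivity)
            exact mul_le_mul hwB (h.trans hC) (norm_nonneg _) (by positivity)
        _ = B * |C₁| * Skeleton.bigP D * eps1 c₁ D *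
              (G D d₁ d₂ k / ((d₁ : ℝ) * d₂ * (Nat.totient k : ℝ))) := by
            field_simp
    · have hz : a₂ (d₁ * d₂ * k) = 0 := ha₂.2 _ (not_lt.mp hlt)
      have hw0 : w d₁ d₂ k = 0 := by simp only [hw, hz, zero_mul, zero_div]
      rw [hw0, norm_zero, zero_mul, mul_zero]
      positivity
  rw [← hMeq, hsplit]
  have hS := hsum D hD₃D
  have habs := hD₁ D hD₁D
  rw [abs_of_nonneg hB0] at habs
  have hS0 : 0 ≤ ∑ d₁ ∈ Finset.Ico 1 (Skeleton.Nsupp D), ∑ d₂ ∈ Finset.Ico 1 (Skeleton.Nsupp D),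
      ∑ k ∈ Finset.Ico 1 (Skeleton.Nsupp D), G D d₁ d₂ k / ((d₁ : ℝ) * d₂ * (Nat.totient k : ℝ)) :=
    Finset.sum_nonneg fun d₁ _ => Finset.sum_nonneg fun d₂ _ => Finset.sum_nonneg fun k _ => by
      have := hG D d₁ d₂ k
      positivity
  calc ‖∑ d₁ ∈ Finset.Ico 1 (Skeleton.Nsupp D), ∑ d₂ ∈ Finset.Ico 1 (Skeleton.Nsupp D),
        ((d₁ : ℂ) * d₂)⁻¹ * ∑ k ∈ Finset.Ico 1 (Skeleton.Nsupp D),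
          w d₁ d₂ k * (T d₁ d₂ k - M d₁ d₂ k)‖
      ≤ ∑ d₁ ∈ Finset.Ico 1 (Skeleton.Nsupp D), ∑ d₂ ∈ Finset.Ico 1 (Skeleton.Nsupp D),
          ∑ k ∈ Finset.Ico 1 (Skeleton.Nsupp D),
            B * |C₁| * Skeleton.bigP D * eps1 c₁ D *
              (G D d₁ d₂ k / ((d₁ : ℝ) * d₂ * (Nat.totient k : ℝ))) := by
        refine (norm_sum_le _ _).trans (Finset.sum_le_sum fun d₁ hd₁ => ?_)
        refine (norm_sum_le _ _).trans (Finset.sum_le_sum fun d₂ hd₂ => ?_)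
        rw [Finset.mul_sum]
        refine (norm_sum_le _ _).trans (Finset.sum_le_sum fun k hk => ?_)
        exact hterm d₁ hd₁ d₂ hd₂ k hk
    _ = B * |C₁| * Skeleton.bigP D * eps1 c₁ D *
          ∑ d₁ ∈ Finset.Ico 1 (Skeleton.Nsupp D), ∑ d₂ ∈ Finset.Ico 1 (Skeleton.Nsupp D),
            ∑ k ∈ Finset.Ico 1 (Skeleton.Nsupp D),
              G D d₁ d₂ k / ((d₁ : ℝ) * d₂ * (Nat.totient k : ℝ)) := by
        simp only [Finset.mul_sum]
    _ ≤ B * |C₁| * Skeleton.bigP D * eps1 c₁ D * (C₀ * Skeleton.ell D ^ K) := by gcongr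
    _ ≤ B * |C₁| * Skeleton.bigP D * eps1 c₁ D * (|C₀| * Skeleton.ell D ^ K) := by
        have hℓ : 0 ≤ Skeleton.ell D ^ K := pow_nonneg (Real.log_natCast_nonneg D) K
        have : C₀ * Skeleton.ell D ^ K ≤ |C₀| * Skeleton.ell D ^ K :=
          mul_le_mul_of_nonneg_right (le_abs_self C₀) hℓ
        exact mul_le_mul_of_nonneg_left this (by positivity)
    _ = Skeleton.bigP D * (B * |C₁| * |C₀| * Skeleton.ell D ^ K * eps1 c₁ D) := by ring
    _ ≤ Skeleton.bigP D * eps1 (c₁ / 2) D := mul_le_mul_of_nonneg_left habs hP0.le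
    _ = 1 * (Skeleton.bigP D * eps1 (c₁ / 2) D) := (one_mul _).symm

end Literature.NumberTheory.LFunctions.Zhang2022.Section7dStatements
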